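import Literature.Barriers.AtomisticToContinuum.EnergyAsymptoticsWithoutCondensation
import Mathlib.Analysis.SpecialFunctions.Integrals.Basic
import Mathlib.Analysis.Calculus.ParametricIntervalIntegral
import Mathlib.Analysis.SpecialFunctions.Pow.Deriv
import Mathlib.Analysis.SpecialFunctions.Complex.Arg
import Mathlib.Analysis.Calculus.MeanValue
import Mathlib.Analysis.Complex.RealDeriv
import Mathlib.Analysis.SpecialFunctions.Trigonometric.InverseDeriv
import Mathlib.Analysis.SpecialFunctions.Pow.Asymptotics
import Mathlib.MeasureTheory.Integral.Prod
import Mathlib.Topology.Order.Compact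

/-!
# Proof of `LiebLiniger_bogoliubovTwoOrders`: Bogoliubov's energy to two orders for the δ-gas

This file discharges the named fact
`Literature.Barriers.AtomisticToContinuum.BoseGas.LiebLiniger.LiebLiniger_bogoliubovTwoOrders` of
`Literature/Barriers/AtomisticToContinuum/EnergyAsymptoticsWithoutCondensation.lean`
(`LiebLiniger_bogoliubovTwoOrders_holds`, at the end of the file): for every continuous solution
`f` of the Lieb–Liniger equations (B.14)–(B.15) [LSSY2005, App. B], the scaled energy
`e = ρ⁻³∫ f k²` satisfies `e = γ - (4/3π)γ^{3/2} + o(γ^{3/2})` as `γ = c/ρ → 0⁺` (B.19), uniformly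
over solutions.  Consequently the catalogue entry `EnergyAsymptoticsWithoutCondensation` holds.

**The printed routes.** LSSY quote (B.19) from [LL] (Bogoliubov's perturbation theory, and the
integral equation "solved on a computer"); the rigorous derivation in the literature rests on
Hutson's uniform small-`κ` approximation of the solution of Love's integral equation (a Wiener–Hopf
boundary-layer construction) followed by Gaudin's moment computation [TracyWidom2016, §1.2].
Neither is formalised here.  Instead the file gives a self-contained ELEMENTARY proof of (B.19),
which (as far as we know) is not in print in this form; every ingredient is classical.

**Architecture.** Scale `g(x) = f(Kx)`, `κ = c/K`; then `g - T_κ g = 1/(2π)` on `[-1,1]` with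
`(T_κu)(x) = (1/π)∫_{-1}^{1} κ u(y)dy/(κ²+(x-y)²)` (Love's equation of the circular condenser
[TracyWidom2016, §1.1–1.2]), `m₀ = ∫g = ρ/K`, `γ = κ/m₀`, `e = m₂/m₀³` (`m₂ = ∫x²g`), and (B.19) is
EQUIVALENT to `Δ(κ) := m₂ - κm₀² + (4/3π)(κm₀)^{3/2} → 0` as `κ → 0⁺`.

* **Part A** (`loveOp`, `IsLoveSolution`, `loveOp_one`, `nonneg_of_loveOp_le`): the operator,
  `T_κ1 = (arctan((1-x)/κ) + arctan((1+x)/κ))/π < 1`, and the COMPARISON PRINCIPLE for `I - T_κ`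
  (a continuous supersolution is nonnegative: minimum argument); a priori
  `0 ≤ g ≤ 1/(4arctan(κ/2))`.
* **Part B** (`semicircle_stieltjes`): the Stieltjes transform of the semicircle,
  `∫_{-1}^{1} √(1-y²)dy/(y-z) = π(iW - z)`, `z = x+iκ`, `W = √(1-z²)` (principal branch), proved by
  an ODE in `κ`: differentiation under the integral sign, an integration by parts giving
  `(1-z²)m₁ = -π - zm`, so `(F/W)' = 0` for `F = m - π(iW-z)`, and `F/W → 0` at `κ = ∞`.  Real and
  imaginary parts give the Poisson and conjugate-Poisson transforms `T_κ√(1-·²) = q - κ`,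
  `(1/π)∫(y-x)√(1-y²)/(κ²+(x-y)²) = p - x` with `W = q - ip`, `q² - p² = 1-x²+κ²`, `pq = κx`,
    `q > 0`.
* **Part C**: closed forms `(I-T_κ)G₀ = 1/2π - D/(2πκ)` for the semicircle `G₀ = √(1-x²)/(2πκ)`
  (`D = q - √(1-x²) ≥ 0`, so `G₀` is a SUBSOLUTION) and `(I-T_κ)ψ₀ = (1-2x²) - r₀` for the adjoint
  test function `ψ₀ = (2/3κ)(1-x²)^{3/2}`; the algebra of `p, q, D`; the BARRIER inequality
  `D ≤ 4π√κ(1 - T_κ1)` (`κ ≤ 1/4`), whence `G₀ ≤ g ≤ G₀ + 2/√κ` for every solution.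
* **Part D** (`loveOp_symm`, `IsLoveSolution.duality`, `duality_G0`): `T_κ` is symmetric
  (Fubini), so `∫((I-T_κ)φ)g = (1/2π)∫φ`; with `φ = √(1-·²)/κ` and `φ = ψ₀` this yields the exact
  identities `m₀ = 1/(4κ) + μ`, `μ = ∫(D/κ)g`, and
  `∫(1-2x²)g = 1/(8κ) + J/(3πκ²) + R`, `J = ∫(1-x²)^{3/2}D`, `R = ∫r₀(g - G₀)` (`∫x²√(1-x²) = π/8`).
* **Part E**: pointwise bounds in the weight `ω = 1 - |x| + κ` (`p² ≤ 2κ²/ω`, `Dω^{3/2} ≤ 6κ²`,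
  `|r₀| ≤ 7κ(1+1/ω)`, `κ²x² - 9κ³/ω ≤ (1-x²)p² ≤ κ²x²`, …), the single integral
  `∫_{-1}^{1}dx/ω = 2ℓ`, `ℓ = log((1+κ)/κ)`, and hence `0 ≤ μ ≤ 1 + 25ℓ`, `|R| ≤ 28√κ(1+ℓ)`,
  `κ² - 81κ³ℓ ≤ J ≤ κ²`.
* **Part F**: `Δ = (4/3π)((¼+κμ)^{3/2} - ⅛) + (1/6π)(1 - J/κ²) - R/2 - κμ²`, so
  `|Δ| ≤ 31 u(κ)` with `u = √κ(1+ℓ) → 0`; unscaling and `κm₀ ≥ ¼` give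
  `|e - e_B(γ)| ≤ εγ^{3/2}` once `u(κ) < min(1/625, ε/248)`, and `γ < 2κ₀arctan(κ₀/2)` forces
  `κ < κ₀` by the a priori bound `m₀ ≤ 1/(2arctan(κ/2))`.

Heuristically: the `γ^{3/2}` (Bogoliubov) term comes entirely from the bulk correction
`κ(1-2x²)/√(1-x²)` to `(I-T_κ)ψ₀ ≈ κ|D|ψ₀ + (κ²/2)ψ₀''`, tested against the semicircle; the edge
layers (where `g - G₀ ∼ κ^{-1/2}` on a width `κ`) and the logarithmic term of the capacitance
[TracyWidom2016, §1.2 (CKir)] only enter `μ`, which cancels to the order needed.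

## References

* [LSSY2005] E. H. Lieb, R. Seiringer, J. P. Solovej, J. Yngvason, *The Mathematics of the Bose
  Gas and its Condensation*, Birkhäuser 2005, arXiv:cond-mat/0610117: App. B, (B.14)–(B.19)
  (pp. 105–106 of the arXiv version; held).
* [TracyWidom2016] C. A. Tracy, H. Widom, *On the ground state energy of the δ-function Bose gas*,
  J. Phys. A 49 (2016) 294001, arXiv:1601.04677: §1.1 (the operator `K`, `‖K‖ = (2/π)arctan(1/κ)`,
  (Bogo)), §1.2 (Love's equation, Kirchhoff–Hutson, Gaudin) (held).
* [LiebLiniger1963] E. H. Lieb, W. Liniger, Phys. Rev. 130 (1963) 1605–1616 (LSSY's [LL]).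

## Design notes

No statement or definition of the statement file is changed; the theorem is literally
`LiebLiniger_bogoliubovTwoOrders`.  Auxiliary definitions introduced here (`loveKernel`, `loveOp`,
`IsLoveSolution`, `zc`, `wc`, `Wc`, `qW`, `pW`, `semi`, `mI`, `m1I`, `FI`, `G0`, `Dq`, `psi0`,
`r0`, `omega`, `ell`, `muF`, `JF`, `RF`, `m0F`, `m2F`, `uF`) live in
`Literature.Barriers.AtomisticToContinuum.BoseGas.LiebLiniger` and carry docstrings.  All
constants are explicit; no existence or uniqueness of solutions is used or proved (the fact
quantifies over solutions), although uniqueness follows from the comparison principle.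
-/

noncomputable section

open MeasureTheory Set Filter Real intervalIntegral
open scoped Topology

namespace Literature.Barriers.AtomisticToContinuum.BoseGas.LiebLiniger

/-! ## Part A. The Love operator on `[-1,1]` and the comparison principle -/


/-- The Lieb–Liniger / Love kernel `(1/π) κ/(κ² + (x-y)²)` (the Poisson kernel at height `κ`).
[cite: LSSY2005, App. B (B.14)] -/
def loveKernel (κ x y : ℝ) : ℝ := κ / (κ ^ 2 + (x - y) ^ 2) / π

/-- The Lieb–Liniger (Love) integral operator on `[-1,1]`:
`(T_κ u)(x) = (1/π) ∫_{-1}^{1} κ u(y) dy/(κ² + (x-y)²)`.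
[cite: LSSY2005, App. B (B.14)] [cite: TracyWidom2016, §1.1] -/
def loveOp (κ : ℝ) (u : ℝ → ℝ) (x : ℝ) : ℝ := ∫ y in (-1:ℝ)..1, loveKernel κ x y * u y

/-- A continuous solution of the scaled Lieb–Liniger equation `g - T_κ g = 1/(2π)` on `[-1,1]`.
[cite: LSSY2005, App. B (B.14)] [cite: TracyWidom2016, §1.1 (LLeqn2)] -/
structure IsLoveSolution (κ : ℝ) (g : ℝ → ℝ) : Prop where
  pos : 0 < κ
  continuousOn : ContinuousOn g (Icc (-1) 1)
  eq : ∀ x ∈ Icc (-1:ℝ) 1, g x - loveOp κ g x = 1 / (2 * π)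

/-! ### The kernel -/

/-- The kernel is positive for `κ > 0`. [folklore] -/
theorem loveKernel_pos {κ : ℝ} (hκ : 0 < κ) (x y : ℝ) : 0 < loveKernel κ x y := by
  unfold loveKernel; positivity

/-- The kernel is nonnegative for `κ ≥ 0`. [folklore] -/
theorem loveKernel_nonneg {κ : ℝ} (hκ : 0 ≤ κ) (x y : ℝ) : 0 ≤ loveKernel κ x y := by
  unfold loveKernel; positivity

/-- The kernel is symmetric in `(x, y)`. [folklore] -/
theorem loveKernel_symm (κ x y : ℝ) : loveKernel κ x y = loveKernel κ y x := by
  unfold loveKernel; ring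

/-- `κ² + (x-y)² > 0` for `κ > 0`. [folklore] -/
theorem den_pos {κ : ℝ} (hκ : 0 < κ) (x y : ℝ) : 0 < κ ^ 2 + (x - y) ^ 2 := by positivity

/-- Joint continuity of the kernel in `(x, y)` for `κ ≠ 0`. [folklore] -/
theorem continuous_loveKernel_uncurry {κ : ℝ} (hκ : κ ≠ 0) :
    Continuous fun p : ℝ × ℝ => loveKernel κ p.1 p.2 := by
  unfold loveKernel
  refine Continuous.div_const (Continuous.div continuous_const ?_ ?_) _
  · fun_prop
  · intro p; have : 0 < κ ^ 2 := by positivity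
    positivity

/-- Continuity of the kernel in `y`. [folklore] -/
theorem continuous_loveKernel_right {κ : ℝ} (hκ : κ ≠ 0) (x : ℝ) :
    Continuous fun y => loveKernel κ x y :=
  (continuous_loveKernel_uncurry hκ).comp (Continuous.prodMk_right x)

/-- Continuity of the kernel in `x`. [folklore] -/
theorem continuous_loveKernel_left {κ : ℝ} (hκ : κ ≠ 0) (y : ℝ) :
    Continuous fun x => loveKernel κ x y :=
  (continuous_loveKernel_uncurry hκ).comp (Continuous.prodMk_left y)

/-! ### Integrability and linearity of `T_κ` -/

/-- `y ↦ k(x,y) u(y)` is integrable on `[-1,1]` for `u ∈ C[-1,1]`. [folklore] -/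
theorem intervalIntegrable_kernel_mul {κ : ℝ} (hκ : κ ≠ 0) {u : ℝ → ℝ}
    (hu : ContinuousOn u (Icc (-1) 1)) (x : ℝ) :
    IntervalIntegrable (fun y => loveKernel κ x y * u y) volume (-1) 1 := by
  refine ContinuousOn.intervalIntegrable ?_
  rw [uIcc_of_le (by norm_num)]
  exact (continuous_loveKernel_right hκ x).continuousOn.mul hu

/-- `T_κ (u - v) = T_κ u - T_κ v`. [folklore] -/
theorem loveOp_sub {κ : ℝ} (hκ : κ ≠ 0) {u v : ℝ → ℝ} (hu : ContinuousOn u (Icc (-1) 1))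
    (hv : ContinuousOn v (Icc (-1) 1)) (x : ℝ) :
    loveOp κ (fun y => u y - v y) x = loveOp κ u x - loveOp κ v x := by
  unfold loveOp
  rw [← intervalIntegral.integral_sub (intervalIntegrable_kernel_mul hκ hu x)
    (intervalIntegrable_kernel_mul hκ hv x)]
  congr 1; ext y; ring

/-- `T_κ (u + v) = T_κ u + T_κ v`. [folklore] -/
theorem loveOp_add {κ : ℝ} (hκ : κ ≠ 0) {u v : ℝ → ℝ} (hu : ContinuousOn u (Icc (-1) 1))
    (hv : ContinuousOn v (Icc (-1) 1)) (x : ℝ) :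
    loveOp κ (fun y => u y + v y) x = loveOp κ u x + loveOp κ v x := by
  unfold loveOp
  rw [← intervalIntegral.integral_add (intervalIntegrable_kernel_mul hκ hu x)
    (intervalIntegrable_kernel_mul hκ hv x)]
  congr 1; ext y; ring

/-- `T_κ (c u) = c T_κ u`. [folklore] -/
theorem loveOp_const_mul (κ : ℝ) (c : ℝ) (u : ℝ → ℝ) (x : ℝ) :
    loveOp κ (fun y => c * u y) x = c * loveOp κ u x := by
  unfold loveOp
  rw [← intervalIntegral.integral_const_mul]
  congr 1; ext y; ring

/-- `T_κ u` only depends on `u|[-1,1]`. [folklore] -/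
theorem loveOp_congr {κ : ℝ} {u v : ℝ → ℝ} (h : ∀ y ∈ Icc (-1:ℝ) 1, u y = v y) (x : ℝ) :
    loveOp κ u x = loveOp κ v x := by
  unfold loveOp
  refine intervalIntegral.integral_congr (fun y hy => ?_)
  rw [uIcc_of_le (by norm_num)] at hy
  simp only [h y hy]

/-- Monotonicity: `T_κ` has a nonnegative kernel. [folklore] -/
theorem loveOp_mono {κ : ℝ} (hκ : 0 < κ) {u v : ℝ → ℝ} (hu : ContinuousOn u (Icc (-1) 1))
    (hv : ContinuousOn v (Icc (-1) 1)) (h : ∀ y ∈ Icc (-1:ℝ) 1, u y ≤ v y) (x : ℝ) :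
    loveOp κ u x ≤ loveOp κ v x := by
  unfold loveOp
  refine intervalIntegral.integral_mono_on (by norm_num)
    (intervalIntegrable_kernel_mul hκ.ne' hu x) (intervalIntegrable_kernel_mul hκ.ne' hv x) ?_
  intro y hy
  exact mul_le_mul_of_nonneg_left (h y hy) (loveKernel_nonneg hκ.le x y)

/-! ### `T_κ 1` in closed form -/

/-- `d/dy arctan((y-x)/κ) = κ/(κ² + (x-y)²)`. [folklore] -/
theorem hasDerivAt_arctan_kernel {κ : ℝ} (hκ : κ ≠ 0) (x y : ℝ) :
    HasDerivAt (fun y => arctan ((y - x) / κ)) (κ / (κ ^ 2 + (x - y) ^ 2)) y := by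
  have h1 : HasDerivAt (fun y : ℝ => (y - x) / κ) (1 / κ) y := by
    simpa using ((hasDerivAt_id y).sub_const x).div_const κ
  have h2 := (Real.hasDerivAt_arctan ((y - x) / κ)).comp y h1
  refine h2.congr_deriv ?_
  have : κ ^ 2 + (x - y) ^ 2 ≠ 0 := by positivity
  field_simp
  ring

/-- `(T_κ 1)(x) = (arctan((1-x)/κ) + arctan((1+x)/κ))/π`. [folklore] -/
theorem loveOp_one {κ : ℝ} (hκ : κ ≠ 0) (x : ℝ) :
    loveOp κ (fun _ => 1) x = (arctan ((1 - x) / κ) + arctan ((1 + x) / κ)) / π := by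
  unfold loveOp loveKernel
  have hint : IntervalIntegrable (fun y => κ / (κ ^ 2 + (x - y) ^ 2)) volume (-1) 1 := by
    refine (Continuous.div continuous_const (by fun_prop) (fun y => ?_)).intervalIntegrable _ _
    positivity
  have := intervalIntegral.integral_eq_sub_of_hasDerivAt
    (fun y _ => hasDerivAt_arctan_kernel hκ x y) hint
  simp only [mul_one]
  rw [intervalIntegral.integral_div, this]
  rw [show ((-1 : ℝ) - x) / κ = -((1 + x) / κ) by ring, arctan_neg]
  ring

/-- The strict sub-Markov property `(T_κ 1)(x) < 1`. [folklore] -/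
theorem loveOp_one_lt_one {κ : ℝ} (hκ : 0 < κ) (x : ℝ) : loveOp κ (fun _ => 1) x < 1 := by
  rw [loveOp_one hκ.ne', div_lt_one Real.pi_pos]
  have h1 := arctan_lt_pi_div_two ((1 - x) / κ)
  have h2 := arctan_lt_pi_div_two ((1 + x) / κ)
  linarith

/-- Quantitative version on `[-1,1]`: `(T_κ 1)(x) ≤ (2/π) arctan(2/κ)`, i.e.
`1 - T_κ 1 ≥ (2/π) arctan(κ/2)`. [folklore] -/
theorem one_sub_loveOp_one_ge {κ : ℝ} (hκ : 0 < κ) {x : ℝ} (hx : x ∈ Icc (-1:ℝ) 1) :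
    2 / π * arctan (κ / 2) ≤ 1 - loveOp κ (fun _ => 1) x := by
  rw [loveOp_one hκ.ne']
  have h1 : arctan ((1 - x) / κ) ≤ arctan (2 / κ) :=
    arctan_mono (by gcongr; linarith [hx.1])
  have h2 : arctan ((1 + x) / κ) ≤ arctan (2 / κ) :=
    arctan_mono (by gcongr; linarith [hx.2])
  have h3 : arctan (κ / 2) = π / 2 - arctan (2 / κ) := by
    rw [show κ / 2 = (2 / κ)⁻¹ by field_simp, arctan_inv_of_pos (by positivity)]
  rw [h3]
  have hπ := Real.pi_pos
  rw [div_mul_eq_mul_div, div_le_iff₀ hπ]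
  have : (arctan ((1 - x) / κ) + arctan ((1 + x) / κ)) / π * π =
      arctan ((1 - x) / κ) + arctan ((1 + x) / κ) := by field_simp
  nlinarith [this]

/-! ### The comparison principle -/

/-- **Comparison principle for `I - T_κ`.** A continuous supersolution on `[-1,1]`
(`u - T_κ u ≥ 0`) is nonnegative: at a negative minimum `x₀`, `T_κ u(x₀) ≥ u(x₀)·T_κ1(x₀) >
u(x₀)`. [folklore] -/
theorem nonneg_of_loveOp_le {κ : ℝ} (hκ : 0 < κ) {u : ℝ → ℝ} (hu : ContinuousOn u (Icc (-1) 1))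
    (h : ∀ x ∈ Icc (-1:ℝ) 1, loveOp κ u x ≤ u x) : ∀ x ∈ Icc (-1:ℝ) 1, 0 ≤ u x := by
  obtain ⟨x₀, hx₀, hmin⟩ := (isCompact_Icc (a := (-1:ℝ)) (b := 1)).exists_isMinOn
    (nonempty_Icc.mpr (by norm_num)) hu
  by_contra! hneg
  obtain ⟨x₁, hx₁, hux₁⟩ := hneg
  have hu0 : u x₀ < 0 := lt_of_le_of_lt (hmin hx₁) hux₁
  -- `T u (x₀) ≥ u(x₀) · T 1 (x₀)`
  have hT : u x₀ * loveOp κ (fun _ => 1) x₀ ≤ loveOp κ u x₀ := by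
    rw [← loveOp_const_mul]
    refine loveOp_mono hκ continuousOn_const hu (fun y hy => ?_) x₀
    simpa using hmin hy
  have hlt := loveOp_one_lt_one hκ x₀
  have := h x₀ hx₀
  -- u x₀ ≥ T u x₀ ≥ u x₀ * T1 x₀ > u x₀ (as u x₀ < 0 and T1 < 1)
  nlinarith

/-- Comparison form: if `u - T_κ u ≤ v - T_κ v` on `[-1,1]` then `u ≤ v`. [folklore] -/
theorem le_of_sub_loveOp_le {κ : ℝ} (hκ : 0 < κ) {u v : ℝ → ℝ}
    (hu : ContinuousOn u (Icc (-1) 1)) (hv : ContinuousOn v (Icc (-1) 1))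
    (h : ∀ x ∈ Icc (-1:ℝ) 1, u x - loveOp κ u x ≤ v x - loveOp κ v x) :
    ∀ x ∈ Icc (-1:ℝ) 1, u x ≤ v x := by
  have key := nonneg_of_loveOp_le hκ (hv.sub hu) (fun x hx => ?_)
  · intro x hx; have := key x hx; simp at this; linarith
  · have := h x hx
    rw [show (v - u) = fun y => v y - u y from rfl, loveOp_sub hκ.ne' hv hu]
    linarith

/-! ### A priori bounds for solutions -/

/-- A solution is bounded above by the constant supersolution `1/(4 arctan(κ/2))`. [folklore] -/
theorem IsLoveSolution.le_const {κ : ℝ} {g : ℝ → ℝ} (hg : IsLoveSolution κ g) :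
    ∀ x ∈ Icc (-1:ℝ) 1, g x ≤ 1 / (4 * arctan (κ / 2)) := by
  have hκ := hg.pos
  have ha : 0 < arctan (κ / 2) := by
    rw [← arctan_zero]; exact arctan_strictMono (by positivity)
  set M : ℝ := 1 / (4 * arctan (κ / 2)) with hM
  refine le_of_sub_loveOp_le hκ hg.continuousOn continuousOn_const (fun x hx => ?_)
  rw [hg.eq x hx]
  have h1 := one_sub_loveOp_one_ge hκ hx
  have hTM : loveOp κ (fun _ => M) x = M * loveOp κ (fun _ => 1) x := by
    rw [← loveOp_const_mul]; simp
  rw [hTM]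
  have hMpos : 0 < M := by positivity
  calc 1 / (2 * π) = M * (2 / π * arctan (κ / 2)) := by
        rw [hM]; field_simp; ring
    _ ≤ M * (1 - loveOp κ (fun _ => 1) x) := by gcongr
    _ = M - M * loveOp κ (fun _ => 1) x := by ring

/-- A solution is nonnegative on `[-1,1]` (comparison with the zero subsolution). [folklore] -/
theorem IsLoveSolution.nonneg {κ : ℝ} {g : ℝ → ℝ} (hg : IsLoveSolution κ g) :
    ∀ x ∈ Icc (-1:ℝ) 1, 0 ≤ g x := by
  refine nonneg_of_loveOp_le hg.pos hg.continuousOn (fun x hx => ?_)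
  have := hg.eq x hx
  have : 0 < 1 / (2 * π) := by positivity
  linarith

/-- The zeroth moment of a solution is at most `1/(2 arctan(κ/2))`. [folklore] -/
theorem IsLoveSolution.integral_le {κ : ℝ} {g : ℝ → ℝ} (hg : IsLoveSolution κ g) :
    ∫ x in (-1:ℝ)..1, g x ≤ 1 / (2 * arctan (κ / 2)) := by
  have hint : IntervalIntegrable g volume (-1) 1 := by
    refine ContinuousOn.intervalIntegrable ?_
    rw [uIcc_of_le (by norm_num)]; exact hg.continuousOn
  calc ∫ x in (-1:ℝ)..1, g x ≤ ∫ _ in (-1:ℝ)..1, 1 / (4 * arctan (κ / 2)) :=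
        intervalIntegral.integral_mono_on (by norm_num) hint intervalIntegrable_const
          (fun x hx => hg.le_const x hx)
    _ = 1 / (2 * arctan (κ / 2)) := by
        rw [intervalIntegral.integral_const]; norm_num; ring


/-! ## Part B. The semicircle transforms (Stieltjes transform of the semicircle) -/


/-- The point `z = x + iκ` of the upper half-plane. [folklore] -/
def zc (x κ : ℝ) : ℂ := (x : ℂ) + (κ : ℂ) * Complex.I

/-- `1 - z²`. [folklore] -/
def wc (x κ : ℝ) : ℂ := 1 - zc x κ ^ 2

/-- `W = √(1 - z²)`, principal branch. [folklore] -/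
def Wc (x κ : ℝ) : ℂ := wc x κ ^ (2⁻¹ : ℂ)

/-- `Re z = x`. [folklore] -/
theorem zc_re (x κ : ℝ) : (zc x κ).re = x := by simp [zc]

/-- `Im z = κ`. [folklore] -/
theorem zc_im (x κ : ℝ) : (zc x κ).im = κ := by simp [zc]

/-- `Re(1 - z²) = 1 - x² + κ²`. [folklore] -/
theorem wc_re (x κ : ℝ) : (wc x κ).re = 1 - x ^ 2 + κ ^ 2 := by
  simp [wc, zc, sq, Complex.mul_re, Complex.mul_im]; ring

/-- `Im(1 - z²) = -2κx`. [folklore] -/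
theorem wc_im (x κ : ℝ) : (wc x κ).im = -(2 * κ * x) := by
  simp [wc, zc, sq, Complex.mul_re, Complex.mul_im]; ring

/-- `1 - z²` lies in the slit plane for `κ ≠ 0`. [folklore] -/
theorem wc_mem_slitPlane (x : ℝ) {κ : ℝ} (hκ : κ ≠ 0) : wc x κ ∈ Complex.slitPlane := by
  rw [Complex.mem_slitPlane_iff, wc_re, wc_im]
  by_cases hx : x = 0
  · left; subst hx; nlinarith [sq_nonneg κ]
  · right; simp [hx, hκ]

/-- `1 - z² ≠ 0` for `κ ≠ 0`. [folklore] -/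
theorem wc_ne_zero (x : ℝ) {κ : ℝ} (hκ : κ ≠ 0) : wc x κ ≠ 0 :=
  Complex.slitPlane_ne_zero (wc_mem_slitPlane x hκ)

/-- `W² = 1 - z²`. [folklore] -/
theorem Wc_sq (x κ : ℝ) : Wc x κ ^ 2 = wc x κ := by
  unfold Wc; exact Complex.cpow_ofNat_inv_pow _ 2

/-- `W ≠ 0` for `κ ≠ 0`. [folklore] -/
theorem Wc_ne_zero (x : ℝ) {κ : ℝ} (hκ : κ ≠ 0) : Wc x κ ≠ 0 := by
  intro h
  have := Wc_sq x κ
  rw [h] at this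
  exact wc_ne_zero x hκ (by simpa using this.symm)

/-- The principal square root of a point of the slit plane has positive real part. [folklore] -/
theorem re_cpow_half_pos_of_mem_slitPlane {w : ℂ} (hw : w ∈ Complex.slitPlane) :
    0 < (w ^ (2⁻¹ : ℂ)).re := by
  have hw0 : w ≠ 0 := Complex.slitPlane_ne_zero hw
  have harg : w.arg ≠ π := Complex.slitPlane_arg_ne_pi hw
  rw [Complex.cpow_def_of_ne_zero hw0, Complex.exp_re]
  have h1 : (Complex.log w * 2⁻¹).im = Complex.arg w / 2 := by
    rw [show (2⁻¹ : ℂ) = ((2⁻¹ : ℝ) : ℂ) by norm_num, mul_comm, Complex.im_ofReal_mul,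
      Complex.log_im]
    ring
  refine mul_pos (Real.exp_pos _) (Real.cos_pos_of_mem_Ioo ⟨?_, ?_⟩)
  · rw [h1]
    have := Complex.neg_pi_lt_arg w
    linarith [Real.pi_pos]
  · rw [h1]
    have h2 := Complex.arg_le_pi w
    have h3 : Complex.arg w < π := lt_of_le_of_ne h2 harg
    linarith [Real.pi_pos]

/-- `Re W > 0` for `κ ≠ 0`. [folklore] -/
theorem Wc_re_pos (x : ℝ) {κ : ℝ} (hκ : κ ≠ 0) : 0 < (Wc x κ).re :=
  re_cpow_half_pos_of_mem_slitPlane (wc_mem_slitPlane x hκ)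

/-- `q = Re W`. [folklore] -/
def qW (x κ : ℝ) : ℝ := (Wc x κ).re

/-- `p = -Im W`. [folklore] -/
def pW (x κ : ℝ) : ℝ := -(Wc x κ).im

/-- `q > 0` for `κ ≠ 0`. [folklore] -/
theorem qW_pos (x : ℝ) {κ : ℝ} (hκ : κ ≠ 0) : 0 < qW x κ := Wc_re_pos x hκ

/-- `W = q - i p`. [folklore] -/
theorem Wc_eq (x κ : ℝ) : Wc x κ = (qW x κ : ℂ) - (pW x κ : ℂ) * Complex.I := by
  apply Complex.ext <;> simp [qW, pW]

/-- `q² - p² = 1 - x² + κ²`. [folklore] -/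
theorem qW_sq_sub_pW_sq (x κ : ℝ) : qW x κ ^ 2 - pW x κ ^ 2 = 1 - x ^ 2 + κ ^ 2 := by
  have h := congrArg Complex.re (Wc_sq x κ)
  rw [wc_re, Wc_eq] at h
  have e : (((qW x κ : ℂ) - (pW x κ : ℂ) * Complex.I) ^ 2).re = qW x κ ^ 2 - pW x κ ^ 2 := by
    simp [sq, Complex.mul_re, Complex.mul_im]
  linarith [e.symm.trans h]

/-- `p q = κ x`. [folklore] -/
theorem pW_mul_qW (x κ : ℝ) : pW x κ * qW x κ = κ * x := by
  have h := congrArg Complex.im (Wc_sq x κ)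
  rw [wc_im, Wc_eq] at h
  have e : (((qW x κ : ℂ) - (pW x κ : ℂ) * Complex.I) ^ 2).im = -(2 * pW x κ * qW x κ) := by
    simp [sq, Complex.mul_re, Complex.mul_im]; ring
  linarith [e.symm.trans h]

/-- `dz/dκ = i`. [folklore] -/
theorem hasDerivAt_zc (x κ : ℝ) : HasDerivAt (fun κ' : ℝ => zc x κ') Complex.I κ := by
  unfold zc
  have h1 : HasDerivAt (fun κ' : ℝ => (κ' : ℂ)) 1 κ := Complex.ofRealCLM.hasDerivAt
  have := (h1.mul_const Complex.I).const_add (x : ℂ)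
  simpa using this

/-- `d(1-z²)/dκ = -2zi`. [folklore] -/
theorem hasDerivAt_wc (x κ : ℝ) :
    HasDerivAt (fun κ' : ℝ => wc x κ') (-(2 * zc x κ * Complex.I)) κ := by
  have h := ((hasDerivAt_zc x κ).pow 2).const_sub (1 : ℂ)
  have h2 : HasDerivAt (fun κ' : ℝ => wc x κ')
      (-(((2 : ℕ) : ℂ) * zc x κ ^ (2 - 1) * Complex.I)) κ := h
  refine h2.congr_deriv ?_
  norm_num

/-- `dW/dκ = -i z / W`. [folklore] -/
theorem hasDerivAt_Wc (x : ℝ) {κ : ℝ} (hκ : κ ≠ 0) :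
    HasDerivAt (fun κ' => Wc x κ') (-(Complex.I * zc x κ) / Wc x κ) κ := by
  have hw0 := wc_ne_zero x hκ
  have hW0 := Wc_ne_zero x hκ
  have hcp : HasDerivAt (fun w : ℂ => w ^ (2⁻¹ : ℂ))
      ((2⁻¹ : ℂ) * wc x κ ^ ((2⁻¹ : ℂ) - 1)) (wc x κ) :=
    (Complex.hasStrictDerivAt_cpow_const (wc_mem_slitPlane x hκ)).hasDerivAt
  have hcomp := hcp.comp κ (hasDerivAt_wc x κ)
  have hpow : wc x κ ^ ((2⁻¹ : ℂ) - 1) = (Wc x κ)⁻¹ := by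
    rw [Complex.cpow_sub _ _ hw0, Complex.cpow_one]
    change Wc x κ / wc x κ = (Wc x κ)⁻¹
    rw [← Wc_sq, sq]
    field_simp
  have hfun : (fun κ' => Wc x κ') = (fun w : ℂ => w ^ (2⁻¹ : ℂ)) ∘ (fun κ' => wc x κ') := rfl
  rw [hfun]
  refine hcomp.congr_deriv ?_
  rw [hpow]
  field_simp


/-! ### The semicircle Stieltjes integral and its `κ`-derivative -/

/-- The semicircle profile `√(1 - y²)` (`= 0` for `|y| ≥ 1`, by `Real.sqrt` of a nonpositive
number). [folklore] -/
def semi (y : ℝ) : ℝ := √(1 - y ^ 2)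

/-- `√(1-y²) ≥ 0`. [folklore] -/
theorem semi_nonneg (y : ℝ) : 0 ≤ semi y := Real.sqrt_nonneg _

/-- `√(1-y²) ≤ 1`. [folklore] -/
theorem semi_le_one (y : ℝ) : semi y ≤ 1 := by
  unfold semi
  calc √(1 - y ^ 2) ≤ √1 := Real.sqrt_le_sqrt (by nlinarith [sq_nonneg y])
    _ = 1 := Real.sqrt_one

/-- Continuity of the semicircle profile. [folklore] -/
theorem continuous_semi : Continuous semi :=
  Real.continuous_sqrt.comp (continuous_const.sub (continuous_pow 2))

/-- `Im(y - z) = -κ`. [folklore] -/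
theorem sub_zc_im (y x κ : ℝ) : ((y : ℂ) - zc x κ).im = -κ := by simp [zc]

/-- `y - z ≠ 0` for real `y` and `κ ≠ 0`. [folklore] -/
theorem sub_zc_ne_zero (y x : ℝ) {κ : ℝ} (hκ : κ ≠ 0) : (y : ℂ) - zc x κ ≠ 0 := by
  intro h
  have := congrArg Complex.im h
  rw [sub_zc_im] at this
  simp at this
  exact hκ this

/-- `|y - z| ≥ κ`. [folklore] -/
theorem le_norm_sub_zc (y x : ℝ) {κ : ℝ} (hκ : 0 < κ) : κ ≤ ‖(y : ℂ) - zc x κ‖ := by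
  have h := Complex.abs_im_le_norm ((y : ℂ) - zc x κ)
  rw [sub_zc_im, abs_neg, abs_of_pos hκ] at h
  exact h

/-- `m(κ) = ∫_{-1}^{1} √(1-y²)/(y - z) dy`. [folklore] -/
def mI (x κ : ℝ) : ℂ := ∫ y in (-1:ℝ)..1, (semi y : ℂ) / ((y : ℂ) - zc x κ)

/-- `m₁(κ) = ∫_{-1}^{1} √(1-y²)/(y - z)² dy`. [folklore] -/
def m1I (x κ : ℝ) : ℂ := ∫ y in (-1:ℝ)..1, (semi y : ℂ) / ((y : ℂ) - zc x κ) ^ 2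

/-- Continuity of `y ↦ √(1-y²)/(y-z)`. [folklore] -/
theorem continuous_integrand (x : ℝ) {κ : ℝ} (hκ : κ ≠ 0) :
    Continuous fun y : ℝ => (semi y : ℂ) / ((y : ℂ) - zc x κ) :=
  (Complex.continuous_ofReal.comp continuous_semi).div
    (Complex.continuous_ofReal.sub continuous_const) (fun y => sub_zc_ne_zero y x hκ)

/-- Continuity of `y ↦ √(1-y²)/(y-z)²`. [folklore] -/
theorem continuous_integrand_sq (x : ℝ) {κ : ℝ} (hκ : κ ≠ 0) :
    Continuous fun y : ℝ => (semi y : ℂ) / ((y : ℂ) - zc x κ) ^ 2 :=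
  (Complex.continuous_ofReal.comp continuous_semi).div
    ((Complex.continuous_ofReal.sub continuous_const).pow 2)
    (fun y => pow_ne_zero _ (sub_zc_ne_zero y x hκ))

/-- `d(y - z)/dκ = -i`. [folklore] -/
theorem hasDerivAt_sub_zc (y x κ : ℝ) :
    HasDerivAt (fun κ' : ℝ => (y : ℂ) - zc x κ') (-Complex.I) κ := by
  simpa using (hasDerivAt_zc x κ).const_sub (y : ℂ)

/-- Differentiation under the integral sign: `m'(κ) = i · m₁(κ)`. [folklore] -/
theorem hasDerivAt_mI (x : ℝ) {κ : ℝ} (hκ : 0 < κ) :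
    HasDerivAt (fun κ' => mI x κ') (Complex.I * m1I x κ) κ := by
  have hs : Ioi (κ / 2) ∈ 𝓝 κ := Ioi_mem_nhds (by linarith)
  have key := intervalIntegral.hasDerivAt_integral_of_dominated_loc_of_deriv_le
    (μ := volume) (a := (-1 : ℝ)) (b := 1)
    (F := fun κ' y => (semi y : ℂ) / ((y : ℂ) - zc x κ'))
    (F' := fun κ' y => (semi y : ℂ) * Complex.I / ((y : ℂ) - zc x κ') ^ 2)
    (x₀ := κ) (bound := fun _ => 4 / κ ^ 2) hs ?_ ?_ ?_ ?_ ?_ ?_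
  · have e : Complex.I * m1I x κ =
        ∫ y in (-1:ℝ)..1, (semi y : ℂ) * Complex.I / ((y : ℂ) - zc x κ) ^ 2 := by
      unfold m1I
      rw [← intervalIntegral.integral_const_mul]
      congr 1; ext y; ring
    rw [e]; exact key.2
  · filter_upwards [hs] with κ' hκ'
    have hκ'0 : κ' ≠ 0 := by simp only [mem_Ioi] at hκ'; exact (by linarith : (0:ℝ) < κ').ne'
    exact (continuous_integrand x hκ'0).aestronglyMeasurable
  · exact (continuous_integrand x hκ.ne').intervalIntegrable _ _
  · exact ((Complex.continuous_ofReal.comp continuous_semi).mul continuous_const).div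
      ((Complex.continuous_ofReal.sub continuous_const).pow 2)
      (fun y => pow_ne_zero _ (sub_zc_ne_zero y x hκ.ne')) |>.aestronglyMeasurable
  · refine Filter.Eventually.of_forall (fun y _ κ' hκ' => ?_)
    simp only [mem_Ioi] at hκ'
    have hκ'pos : 0 < κ' := by linarith
    have hden : κ' ≤ ‖(y : ℂ) - zc x κ'‖ := le_norm_sub_zc y x hκ'pos
    rw [norm_div, norm_mul, norm_pow, Complex.norm_I, mul_one, Complex.norm_real,
      Real.norm_eq_abs, abs_of_nonneg (semi_nonneg y)]
    have h1 : semi y / ‖(y : ℂ) - zc x κ'‖ ^ 2 ≤ 1 / κ' ^ 2 := by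
      have : 0 < ‖(y : ℂ) - zc x κ'‖ ^ 2 := pow_pos (lt_of_lt_of_le hκ'pos hden) 2
      rw [div_le_div_iff₀ this (by positivity)]
      calc semi y * κ' ^ 2 ≤ 1 * κ' ^ 2 := by gcongr; exact semi_le_one y
        _ ≤ 1 * ‖(y : ℂ) - zc x κ'‖ ^ 2 := by gcongr
    calc semi y / ‖(y : ℂ) - zc x κ'‖ ^ 2 ≤ 1 / κ' ^ 2 := h1
      _ ≤ 4 / κ ^ 2 := by
        rw [div_le_div_iff₀ (by positivity) (by positivity)]
        nlinarith
  · exact intervalIntegrable_const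
  · refine Filter.Eventually.of_forall (fun y _ κ' hκ' => ?_)
    simp only [mem_Ioi] at hκ'
    have hκ'0 : κ' ≠ 0 := (by linarith : (0:ℝ) < κ').ne'
    have hd := hasDerivAt_sub_zc y x κ'
    have := (hasDerivAt_const κ' (semi y : ℂ)).div hd (sub_zc_ne_zero y x hκ'0)
    refine this.congr_deriv ?_
    ring

/-! ### Integration by parts: `(1 - z²) m₁ = -π - z m` -/

/-- `∫_{-1}^{1} √(1-y²) dy = π/2` (complex-valued form). [folklore] -/
theorem integral_semi_complex : ∫ y in (-1:ℝ)..1, (semi y : ℂ) = ((π / 2 : ℝ) : ℂ) := by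
  rw [intervalIntegral.integral_ofReal]
  simp only [semi]
  rw [integral_sqrt_one_sub_sq]

/-- `d/dy (1-y²)^{3/2} = -3y√(1-y²)` on `(-1,1)`. [folklore] -/
theorem hasDerivAt_cube_semi {y : ℝ} (hy : y ∈ Ioo (-1:ℝ) 1) :
    HasDerivAt (fun y => (1 - y ^ 2) * semi y) (-3 * y * semi y) y := by
  have hpos : 0 < 1 - y ^ 2 := by
    rcases hy with ⟨h1, h2⟩
    nlinarith
  have hu : HasDerivAt (fun y : ℝ => 1 - y ^ 2) (-(2 * y)) y := by
    simpa using ((hasDerivAt_id y).pow 2).const_sub (1:ℝ)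
  have hv : HasDerivAt semi (1 / (2 * √(1 - y ^ 2)) * (-(2 * y))) y := by
    unfold semi
    exact (Real.hasDerivAt_sqrt hpos.ne').comp y hu
  have huv := hu.mul hv
  refine huv.congr_deriv ?_
  have hs : 0 < √(1 - y ^ 2) := Real.sqrt_pos.mpr hpos
  have hss : √(1 - y ^ 2) * √(1 - y ^ 2) = 1 - y ^ 2 := Real.mul_self_sqrt hpos.le
  simp only [semi]
  set s := √(1 - y ^ 2) with hsdef
  rw [← hss]
  field_simp
  ring

/-- Integration by parts: `(1 - z²) m₁ = -π - z m` (the boundary term `(1-y²)^{3/2}/(y-z)`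
vanishes at `±1`). [folklore] -/
theorem ibp_identity (x : ℝ) {κ : ℝ} (hκ : κ ≠ 0) :
    (1 - zc x κ ^ 2) * m1I x κ = -π - zc x κ * mI x κ := by
  set z := zc x κ with hz
  have hne : ∀ y : ℝ, (y : ℂ) - z ≠ 0 := fun y => sub_zc_ne_zero y x hκ
  -- the boundary function and its derivative
  set Y : ℝ → ℂ := fun y => (((1 - y ^ 2) * semi y : ℝ) : ℂ) / ((y : ℂ) - z) with hY
  set Y' : ℝ → ℂ := fun y =>
    ((-3 * y * semi y : ℝ) : ℂ) / ((y : ℂ) - z) -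
      (((1 - y ^ 2) * semi y : ℝ) : ℂ) / ((y : ℂ) - z) ^ 2 with hY'
  have hderiv : ∀ y ∈ Ioo (-1:ℝ) 1, HasDerivAt Y (Y' y) y := by
    intro y hy
    have h1 := (hasDerivAt_cube_semi hy).ofReal_comp
    have h2 : HasDerivAt (fun y : ℝ => (y : ℂ) - z) 1 y := by
      simpa using (Complex.ofRealCLM.hasDerivAt (x := y)).sub_const z
    have := h1.div h2 (hne y)
    refine this.congr_deriv ?_
    rw [hY']
    simp only
    field_simp
  have hcontY : Continuous Y :=
    (Complex.continuous_ofReal.comp ((continuous_const.sub (continuous_pow 2)).mul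
      continuous_semi)).div (Complex.continuous_ofReal.sub continuous_const) hne
  have hcontY' : Continuous Y' := by
    refine Continuous.sub ?_ ?_
    · exact (Complex.continuous_ofReal.comp ((continuous_const.mul continuous_id).mul
        continuous_semi)).div (Complex.continuous_ofReal.sub continuous_const) hne
    · exact (Complex.continuous_ofReal.comp ((continuous_const.sub (continuous_pow 2)).mul
        continuous_semi)).div ((Complex.continuous_ofReal.sub continuous_const).pow 2)
        (fun y => pow_ne_zero _ (hne y))
  have hFTC := intervalIntegral.integral_eq_sub_of_hasDerivAt_of_le (by norm_num : (-1:ℝ) ≤ 1)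
    hcontY.continuousOn hderiv (hcontY'.intervalIntegrable _ _)
  have hY1 : Y 1 = 0 := by simp [hY, semi]
  have hYm1 : Y (-1) = 0 := by simp [hY, semi]
  rw [hY1, hYm1, sub_zero] at hFTC
  -- pointwise decomposition of `Y'`
  have hpt : ∀ y : ℝ, Y' y = -2 * (semi y : ℂ) - z * ((semi y : ℂ) / ((y : ℂ) - z))
      - (1 - z ^ 2) * ((semi y : ℂ) / ((y : ℂ) - z) ^ 2) := by
    intro y
    rw [hY']
    simp only
    have := hne y
    field_simp
    push_cast
    ring
  have hint1 : IntervalIntegrable (fun y : ℝ => (semi y : ℂ)) volume (-1) 1 :=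
    (Complex.continuous_ofReal.comp continuous_semi).intervalIntegrable _ _
  have hint2 : IntervalIntegrable (fun y : ℝ => (semi y : ℂ) / ((y : ℂ) - z)) volume (-1) 1 :=
    (continuous_integrand x hκ).intervalIntegrable _ _
  have hint3 : IntervalIntegrable (fun y : ℝ => (semi y : ℂ) / ((y : ℂ) - z) ^ 2) volume (-1) 1 :=
    (continuous_integrand_sq x hκ).intervalIntegrable _ _
  have hsplit : ∫ y in (-1:ℝ)..1, Y' y = -2 * ((π / 2 : ℝ) : ℂ) - z * mI x κ
      - (1 - z ^ 2) * m1I x κ := by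
    rw [intervalIntegral.integral_congr (fun y _ => hpt y)]
    rw [intervalIntegral.integral_sub ((hint1.const_mul _).sub (hint2.const_mul _))
      (hint3.const_mul _), intervalIntegral.integral_sub (hint1.const_mul _) (hint2.const_mul _),
      intervalIntegral.integral_const_mul, intervalIntegral.integral_const_mul,
      intervalIntegral.integral_const_mul, integral_semi_complex]
    rfl
  rw [hsplit] at hFTC
  have : (((π / 2 : ℝ) : ℂ)) = (π : ℂ) / 2 := by push_cast; ring
  rw [this] at hFTC
  linear_combination -hFTC


/-! ### The ODE argument: `m = π (iW - z)` -/

/-- `F(κ) := m(κ) - π (iW(κ) - z(κ))`; we show `F ≡ 0`. [folklore] -/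
def FI (x κ : ℝ) : ℂ := mI x κ - π * (Complex.I * Wc x κ - zc x κ)

/-- `F' = i m₁ - π(i W' - i)`. [folklore] -/
theorem hasDerivAt_FI (x : ℝ) {κ : ℝ} (hκ : 0 < κ) :
    HasDerivAt (fun κ' => FI x κ')
      (Complex.I * m1I x κ - π * (Complex.I * (-(Complex.I * zc x κ) / Wc x κ) - Complex.I)) κ := by
  unfold FI
  exact (hasDerivAt_mI x hκ).sub
    (((hasDerivAt_Wc x hκ.ne').const_mul Complex.I).sub (hasDerivAt_zc x κ) |>.const_mul _)

/-- `(F/W)' = 0` on `(0, ∞)`: the ODE `F' = -izF/(1-z²)` with integrating factor `1/W`.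
[folklore] -/
theorem hasDerivAt_FI_div_Wc (x : ℝ) {κ : ℝ} (hκ : 0 < κ) :
    HasDerivAt (fun κ' => FI x κ' / Wc x κ') 0 κ := by
  have hW0 := Wc_ne_zero x hκ.ne'
  have h := (hasDerivAt_FI x hκ).div (hasDerivAt_Wc x hκ.ne') hW0
  refine h.congr_deriv ?_
  have hW2 : Wc x κ ^ 2 = 1 - zc x κ ^ 2 := Wc_sq x κ
  have hibp := ibp_identity x hκ.ne'
  -- unfold `FI` inside the derivative expression
  simp only [FI]
  field_simp
  linear_combination (Complex.I) * hibp + (Complex.I * m1I x κ + ↑π * Complex.I) * hW2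


/-- `|m(κ)| ≤ 2/κ`. [folklore] -/
theorem norm_mI_le (x : ℝ) {κ : ℝ} (hκ : 0 < κ) : ‖mI x κ‖ ≤ 2 / κ := by
  unfold mI
  have h : ∀ y ∈ Set.uIoc (-1:ℝ) 1, ‖(semi y : ℂ) / ((y : ℂ) - zc x κ)‖ ≤ 1 / κ := by
    intro y _
    rw [norm_div, Complex.norm_real, Real.norm_eq_abs, abs_of_nonneg (semi_nonneg y)]
    have hden := le_norm_sub_zc y x hκ
    have hpos : 0 < ‖(y : ℂ) - zc x κ‖ := lt_of_lt_of_le hκ hden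
    rw [div_le_div_iff₀ hpos hκ]
    calc semi y * κ ≤ 1 * κ := by gcongr; exact semi_le_one y
      _ ≤ 1 * ‖(y : ℂ) - zc x κ‖ := by gcongr
  have := intervalIntegral.norm_integral_le_of_norm_le_const h
  calc ‖∫ y in (-1:ℝ)..1, (semi y : ℂ) / ((y : ℂ) - zc x κ)‖ ≤ 1 / κ * |1 - (-1)| := this
    _ = 2 / κ := by norm_num; ring

/-- `(iW - z)(iW + z) = -1`. [folklore] -/
theorem IW_sub_z_mul (x κ : ℝ) :
    (Complex.I * Wc x κ - zc x κ) * (Complex.I * Wc x κ + zc x κ) = -1 := by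
  have hW2 : Wc x κ ^ 2 = 1 - zc x κ ^ 2 := Wc_sq x κ
  linear_combination (-1 : ℂ) * hW2 + Wc x κ ^ 2 * Complex.I_sq

/-- `|iW - z| ≤ 1/κ` (from `(iW - z)(iW + z) = -1` and `Im(iW + z) ≥ κ`). [folklore] -/
theorem norm_IW_sub_z_le (x : ℝ) {κ : ℝ} (hκ : 0 < κ) :
    ‖Complex.I * Wc x κ - zc x κ‖ ≤ 1 / κ := by
  have hprod := IW_sub_z_mul x κ
  have him : (Complex.I * Wc x κ + zc x κ).im = qW x κ + κ := by
    simp [zc, qW]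
  have hge : κ ≤ ‖Complex.I * Wc x κ + zc x κ‖ := by
    have h := Complex.abs_im_le_norm (Complex.I * Wc x κ + zc x κ)
    rw [him] at h
    have hq := qW_pos x hκ.ne'
    rw [abs_of_pos (by linarith)] at h
    linarith
  have hne : Complex.I * Wc x κ + zc x κ ≠ 0 := by
    intro h0; rw [h0, mul_zero] at hprod; norm_num at hprod
  have heq : Complex.I * Wc x κ - zc x κ = -1 / (Complex.I * Wc x κ + zc x κ) := by
    rw [eq_div_iff hne]; exact hprod
  rw [heq, norm_div, norm_neg, norm_one]
  exact one_div_le_one_div_of_le hκ hge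

/-- `|W| ≥ κ/2` for `κ ≥ 2`. [folklore] -/
theorem norm_Wc_ge (x : ℝ) {κ : ℝ} (hκ : 2 ≤ κ) : κ / 2 ≤ ‖Wc x κ‖ := by
  have hW2 : Wc x κ ^ 2 = 1 - zc x κ ^ 2 := Wc_sq x κ
  have h1 : ‖Wc x κ‖ ^ 2 = ‖1 - zc x κ ^ 2‖ := by rw [← norm_pow, hW2]
  have hz : κ ≤ ‖zc x κ‖ := by
    have h := Complex.abs_im_le_norm (zc x κ)
    rw [zc_im, abs_of_pos (by linarith)] at h
    exact h
  have h2 : ‖zc x κ‖ ^ 2 - 1 ≤ ‖1 - zc x κ ^ 2‖ := by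
    have := norm_sub_norm_le (zc x κ ^ 2) 1
    rw [norm_pow, norm_one, norm_sub_rev] at this
    exact this
  have h3 : (κ / 2) ^ 2 ≤ ‖Wc x κ‖ ^ 2 := by
    rw [h1]
    nlinarith [hz, h2, norm_nonneg (zc x κ)]
  exact (pow_le_pow_iff_left₀ (by linarith) (norm_nonneg _) two_ne_zero).mp h3

/-- `F/W → 0` as `κ → ∞`. [folklore] -/
theorem tendsto_FI_div_Wc (x : ℝ) :
    Tendsto (fun κ => FI x κ / Wc x κ) atTop (𝓝 0) := by
  have hbound : ∀ᶠ κ in atTop, ‖FI x κ / Wc x κ‖ ≤ (2 * (2 + π)) / κ ^ 2 := by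
    filter_upwards [eventually_ge_atTop (2:ℝ)] with κ hκ
    have hκ0 : 0 < κ := by linarith
    have hF : ‖FI x κ‖ ≤ (2 + π) / κ := by
      unfold FI
      calc ‖mI x κ - ↑π * (Complex.I * Wc x κ - zc x κ)‖
          ≤ ‖mI x κ‖ + ‖↑π * (Complex.I * Wc x κ - zc x κ)‖ := norm_sub_le _ _
        _ ≤ 2 / κ + π * (1 / κ) := by
          gcongr
          · exact norm_mI_le x hκ0
          · rw [norm_mul, Complex.norm_real, Real.norm_eq_abs, abs_of_pos Real.pi_pos]
            gcongr
            exact norm_IW_sub_z_le x hκ0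
        _ = (2 + π) / κ := by ring
    have hW := norm_Wc_ge x hκ
    rw [norm_div]
    calc ‖FI x κ‖ / ‖Wc x κ‖ ≤ ((2 + π) / κ) / (κ / 2) := by
          gcongr
      _ = 2 * (2 + π) / κ ^ 2 := by field_simp
  have hlim : Tendsto (fun κ : ℝ => (2 * (2 + π)) / κ ^ 2) atTop (𝓝 0) :=
    tendsto_const_nhds.div_atTop (tendsto_pow_atTop two_ne_zero)
  exact squeeze_zero_norm' hbound hlim

/-- **Stieltjes transform of the semicircle.** For `κ > 0` and real `x`, with `z = x + iκ` and
`W = √(1 - z²)` (principal branch), `∫_{-1}^{1} √(1-y²)/(y - z) dy = π (iW - z)`. [folklore] -/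
theorem semicircle_stieltjes (x : ℝ) {κ : ℝ} (hκ : 0 < κ) :
    mI x κ = π * (Complex.I * Wc x κ - zc x κ) := by
  -- `F/W` is constant on `(0, ∞)` …
  obtain ⟨c, hc⟩ : ∃ c, ∀ κ' ∈ Ioi (0:ℝ), FI x κ' / Wc x κ' = c := by
    refine isOpen_Ioi.exists_is_const_of_deriv_eq_zero isPreconnected_Ioi ?_ ?_
    · intro κ' hκ'
      exact (hasDerivAt_FI_div_Wc x hκ').differentiableAt.differentiableWithinAt
    · intro κ' hκ'
      exact (hasDerivAt_FI_div_Wc x hκ').deriv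
  -- … and tends to `0`, hence vanishes.
  have hc0 : c = 0 := by
    have h1 : Tendsto (fun κ' => FI x κ' / Wc x κ') atTop (𝓝 c) := by
      refine tendsto_const_nhds.congr' ?_
      filter_upwards [eventually_gt_atTop (0:ℝ)] with κ' hκ'
      exact (hc κ' hκ').symm
    exact tendsto_nhds_unique h1 (tendsto_FI_div_Wc x)
  have hF : FI x κ = 0 := by
    have := hc κ hκ
    rw [hc0, div_eq_zero_iff] at this
    exact this.resolve_right (Wc_ne_zero x hκ.ne')
  unfold FI at hF
  exact sub_eq_zero.mp hF

/-! ### Real and imaginary parts: the Poisson and conjugate-Poisson transforms of the semicircle -/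

/-- `|y - z|² = κ² + (x-y)²`. [folklore] -/
theorem normSq_sub_zc (y x κ : ℝ) : Complex.normSq ((y : ℂ) - zc x κ) = κ ^ 2 + (x - y) ^ 2 := by
  rw [Complex.normSq_apply]
  simp [zc]
  ring

/-- `(1/π)·∫ κ√(1-y²)/(κ²+(x-y)²) dy = q - κ`: the Poisson transform of the semicircle.
[folklore] -/
theorem integral_poisson_semi (x : ℝ) {κ : ℝ} (hκ : 0 < κ) :
    ∫ y in (-1:ℝ)..1, κ / (κ ^ 2 + (x - y) ^ 2) * semi y = π * (qW x κ - κ) := by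
  have hmain := congrArg Complex.im (semicircle_stieltjes x hκ)
  have hI : (mI x κ).im = ∫ y in (-1:ℝ)..1, ((semi y : ℂ) / ((y : ℂ) - zc x κ)).im := by
    unfold mI
    exact ((Complex.imCLM).intervalIntegral_comp_comm
      ((continuous_integrand x hκ.ne').intervalIntegrable _ _)).symm
  have hpt : ∀ y : ℝ,
      ((semi y : ℂ) / ((y : ℂ) - zc x κ)).im = κ / (κ ^ 2 + (x - y) ^ 2) * semi y := by
    intro y
    rw [Complex.div_im, normSq_sub_zc, sub_zc_im]
    simp
    ring
  rw [hI, intervalIntegral.integral_congr (fun y _ => hpt y)] at hmain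
  rw [hmain]
  simp [zc, qW]

/-- `(1/π)·∫ (y-x)√(1-y²)/(κ²+(x-y)²) dy = p - x`: the conjugate Poisson transform. [folklore] -/
theorem integral_conjPoisson_semi (x : ℝ) {κ : ℝ} (hκ : 0 < κ) :
    ∫ y in (-1:ℝ)..1, (y - x) / (κ ^ 2 + (x - y) ^ 2) * semi y = π * (pW x κ - x) := by
  have hmain := congrArg Complex.re (semicircle_stieltjes x hκ)
  have hR : (mI x κ).re = ∫ y in (-1:ℝ)..1, ((semi y : ℂ) / ((y : ℂ) - zc x κ)).re := by
    unfold mI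
    exact ((Complex.reCLM).intervalIntegral_comp_comm
      ((continuous_integrand x hκ.ne').intervalIntegrable _ _)).symm
  have hpt : ∀ y : ℝ,
      ((semi y : ℂ) / ((y : ℂ) - zc x κ)).re = (y - x) / (κ ^ 2 + (x - y) ^ 2) * semi y := by
    intro y
    rw [Complex.div_re, normSq_sub_zc, sub_zc_im]
    simp [zc]
    ring
  rw [hR, intervalIntegral.integral_congr (fun y _ => hpt y)] at hmain
  rw [hmain]
  simp [zc, pW]



/-! ## Part C. Closed forms on `[-1,1]`: `(I-T)G₀`, `(I-T)ψ₀`; the algebra of `p, q, D` -/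

/-- `√(1-x²)² = 1 - x²` on `[-1,1]`. [folklore] -/
theorem semi_sq {x : ℝ} (hx : x ∈ Icc (-1:ℝ) 1) : semi x ^ 2 = 1 - x ^ 2 := by
  unfold semi
  refine Real.sq_sqrt ?_
  rcases hx with ⟨h1, h2⟩
  nlinarith

/-- `∫_{-1}^{1} √(1-y²) dy = π/2`. [folklore] -/
theorem integral_semi : ∫ y in (-1:ℝ)..1, semi y = π / 2 := by
  simp only [semi]; exact integral_sqrt_one_sub_sq

/-- `T_κ[√(1-·²)](x) = q - κ`. [folklore] -/
theorem loveOp_semi (x : ℝ) {κ : ℝ} (hκ : 0 < κ) : loveOp κ semi x = qW x κ - κ := by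
  unfold loveOp loveKernel
  have h := integral_poisson_semi x hκ
  have : (fun y => κ / (κ ^ 2 + (x - y) ^ 2) / π * semi y) =
      fun y => π⁻¹ * (κ / (κ ^ 2 + (x - y) ^ 2) * semi y) := by
    ext y; ring
  rw [this, intervalIntegral.integral_const_mul, h]
  field_simp

/-- `T_κ[y²√(1-y²)](x) = κ/2 + (x²-κ²) q + 2κx p - 3κx² + κ³`. [folklore] -/
theorem loveOp_sq_mul_semi (x : ℝ) {κ : ℝ} (hκ : 0 < κ) :
    loveOp κ (fun y => y ^ 2 * semi y) x =
      κ / 2 + (x ^ 2 - κ ^ 2) * qW x κ + 2 * κ * x * pW x κ - 3 * κ * x ^ 2 + κ ^ 3 := by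
  unfold loveOp loveKernel
  set kP : ℝ → ℝ := fun y => κ / (κ ^ 2 + (x - y) ^ 2) with hkP
  set kQ : ℝ → ℝ := fun y => (y - x) / (κ ^ 2 + (x - y) ^ 2) with hkQ
  have hpt : ∀ y : ℝ, κ / (κ ^ 2 + (x - y) ^ 2) / π * (y ^ 2 * semi y) =
      π⁻¹ * (κ * semi y - κ ^ 2 * (kP y * semi y) + 2 * x * κ * (kQ y * semi y)
        + x ^ 2 * (kP y * semi y)) := by
    intro y
    simp only [hkP, hkQ]
    have hden : κ ^ 2 + (x - y) ^ 2 ≠ 0 := (den_pos hκ x y).ne'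
    field_simp
    ring
  have hcP : Continuous kP := by
    simp only [hkP]
    exact Continuous.div continuous_const (by fun_prop) (fun y => (den_pos hκ x y).ne')
  have hcQ : Continuous kQ := by
    simp only [hkQ]
    exact Continuous.div (by fun_prop) (by fun_prop) (fun y => (den_pos hκ x y).ne')
  have i1 : IntervalIntegrable (fun y => κ * semi y) volume (-1) 1 :=
    (continuous_const.mul continuous_semi).intervalIntegrable _ _
  have i2 : IntervalIntegrable (fun y => kP y * semi y) volume (-1) 1 :=
    (hcP.mul continuous_semi).intervalIntegrable _ _
  have i3 : IntervalIntegrable (fun y => kQ y * semi y) volume (-1) 1 :=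
    (hcQ.mul continuous_semi).intervalIntegrable _ _
  have hP : ∫ y in (-1:ℝ)..1, kP y * semi y = π * (qW x κ - κ) := integral_poisson_semi x hκ
  have hQ : ∫ y in (-1:ℝ)..1, kQ y * semi y = π * (pW x κ - x) := integral_conjPoisson_semi x hκ
  rw [intervalIntegral.integral_congr (fun y _ => hpt y), intervalIntegral.integral_const_mul,
    intervalIntegral.integral_add ((i1.sub (i2.const_mul _)).add (i3.const_mul _)) (i2.const_mul _),
    intervalIntegral.integral_add (i1.sub (i2.const_mul _)) (i3.const_mul _),
    intervalIntegral.integral_sub i1 (i2.const_mul _),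
    intervalIntegral.integral_const_mul, intervalIntegral.integral_const_mul,
    intervalIntegral.integral_const_mul, intervalIntegral.integral_const_mul, hP, hQ, integral_semi]
  field_simp
  ring

/-- The leading-order density `G₀(x) = √(1-x²)/(2πκ)` (LSSY (B.19): `f = (2πργ)^{-1}(4ρ²γ-k²)^{1/2}`
in scaled variables). [cite: LSSY2005, App. B (B.19)] -/
def G0 (κ x : ℝ) : ℝ := semi x / (2 * π * κ)

/-- The edge discrepancy `D = q - √(1-x²)` (`≥ 0`, `≈ κ²/(2(1-x²)^{3/2})` in the bulk, `≈ √κ` at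
the edges). [folklore] -/
def Dq (x κ : ℝ) : ℝ := qW x κ - semi x

/-- Continuity of `G₀`. [folklore] -/
theorem continuous_G0 (κ : ℝ) : Continuous (G0 κ) := continuous_semi.div_const _

/-- `G₀ - T_κ G₀ = 1/(2π) - D/(2πκ)`: `G₀` is a subsolution. [folklore] -/
theorem G0_sub_loveOp (x : ℝ) {κ : ℝ} (hκ : 0 < κ) :
    G0 κ x - loveOp κ (G0 κ) x = 1 / (2 * π) - Dq x κ / (2 * π * κ) := by
  have h1 : loveOp κ (G0 κ) x = (1 / (2 * π * κ)) * loveOp κ semi x := by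
    rw [← loveOp_const_mul]; unfold G0; congr 1; ext y; ring
  rw [h1, loveOp_semi x hκ]
  unfold G0 Dq
  field_simp
  ring

/-- The adjoint test function `ψ₀ = (2/(3κ))(1-y²)^{3/2}` (solving `κ|D|ψ₀ = 1 - 2y²` on `(-1,1)`).
[folklore] -/
def psi0 (κ y : ℝ) : ℝ := 2 / (3 * κ) * ((1 - y ^ 2) * semi y)

/-- The residual `r₀ = (1-2x²) - (I - T_κ)ψ₀`, in closed form. [folklore] -/
def r0 (κ x : ℝ) : ℝ :=
  2 / (3 * κ) * ((1 - x ^ 2 + κ ^ 2) * qW x κ - (1 - x ^ 2) * semi x - 2 * κ * x * pW x κ)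
    - 2 / 3 * κ ^ 2

/-- Continuity of `ψ₀`. [folklore] -/
theorem continuous_psi0 (κ : ℝ) : Continuous (psi0 κ) :=
  continuous_const.mul ((continuous_const.sub (continuous_pow 2)).mul continuous_semi)

/-- `(I - T_κ)ψ₀ = (1 - 2x²) - r₀`. [folklore] -/
theorem psi0_sub_loveOp (x : ℝ) {κ : ℝ} (hκ : 0 < κ) :
    psi0 κ x - loveOp κ (psi0 κ) x = (1 - 2 * x ^ 2) - r0 κ x := by
  have h1 : loveOp κ (psi0 κ) x =
      2 / (3 * κ) * (loveOp κ semi x - loveOp κ (fun y => y ^ 2 * semi y) x) := by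
    have hv : ContinuousOn (fun y : ℝ => y ^ 2 * semi y) (Icc (-1) 1) :=
      ((continuous_pow 2).mul continuous_semi).continuousOn
    rw [← loveOp_sub hκ.ne' continuous_semi.continuousOn hv, ← loveOp_const_mul]
    unfold psi0; congr 1; ext y; ring
  rw [h1, loveOp_semi x hκ, loveOp_sq_mul_semi x hκ]
  unfold psi0 r0
  field_simp
  ring

/-! ### The algebra of `p`, `q`, `D` on `[-1,1]` -/

section pq
variable {x κ : ℝ}

/-- `1 - x² + κ² > 0` on `[-1,1]`. [folklore] -/
theorem A_pos (hκ : 0 < κ) (hx : x ∈ Icc (-1:ℝ) 1) : 0 < 1 - x ^ 2 + κ ^ 2 := by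
  rcases hx with ⟨h1, h2⟩; nlinarith

/-- `q² = (1 - x² + κ²) + p²`. [folklore] -/
theorem qW_sq_eq (x κ : ℝ) : qW x κ ^ 2 = (1 - x ^ 2 + κ ^ 2) + pW x κ ^ 2 := by
  linarith [qW_sq_sub_pW_sq x κ]

/-- `p² q² = κ² x²`. [folklore] -/
theorem pq_sq (x κ : ℝ) : pW x κ ^ 2 * qW x κ ^ 2 = κ ^ 2 * x ^ 2 := by
  rw [← mul_pow, pW_mul_qW]; ring

/-- `√(1-x²) ≤ q` on `[-1,1]`. [folklore] -/
theorem semi_le_qW (hκ : 0 < κ) (hx : x ∈ Icc (-1:ℝ) 1) : semi x ≤ qW x κ := by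
  have hq := qW_pos x hκ.ne'
  have h : semi x ^ 2 ≤ qW x κ ^ 2 := by
    rw [semi_sq hx, qW_sq_eq]; nlinarith [sq_nonneg (pW x κ), sq_nonneg κ]
  exact (pow_le_pow_iff_left₀ (semi_nonneg x) hq.le two_ne_zero).mp h

/-- `D ≥ 0` on `[-1,1]`. [folklore] -/
theorem Dq_nonneg (hκ : 0 < κ) (hx : x ∈ Icc (-1:ℝ) 1) : 0 ≤ Dq x κ := by
  unfold Dq; linarith [semi_le_qW hκ hx]

/-- `D (q + √(1-x²)) = κ² + p²`. [folklore] -/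
theorem Dq_mul (hx : x ∈ Icc (-1:ℝ) 1) :
    Dq x κ * (qW x κ + semi x) = κ ^ 2 + pW x κ ^ 2 := by
  unfold Dq
  have h1 := qW_sq_eq x κ
  have h2 := semi_sq hx
  nlinarith [h1, h2]

/-- `p² ≤ κ²x²/(1-x²+κ²)`. [folklore] -/
theorem pW_sq_le_bulk (hκ : 0 < κ) (hx : x ∈ Icc (-1:ℝ) 1) :
    pW x κ ^ 2 ≤ κ ^ 2 * x ^ 2 / (1 - x ^ 2 + κ ^ 2) := by
  have hA := A_pos hκ hx
  rw [le_div_iff₀ hA]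
  have h := pq_sq x κ
  rw [qW_sq_eq] at h
  nlinarith [sq_nonneg (pW x κ), sq_nonneg (pW x κ ^ 2)]

/-- `p² ≤ κ|x|`. [folklore] -/
theorem pW_sq_le_edge (hκ : 0 < κ) (hx : x ∈ Icc (-1:ℝ) 1) : pW x κ ^ 2 ≤ κ * |x| := by
  have h := pq_sq x κ
  have hA := A_pos hκ hx
  have hq2 : pW x κ ^ 2 ≤ qW x κ ^ 2 := by rw [qW_sq_eq]; linarith
  have h4 : (pW x κ ^ 2) ^ 2 ≤ (κ * |x|) ^ 2 := by
    calc (pW x κ ^ 2) ^ 2 = pW x κ ^ 2 * pW x κ ^ 2 := by ring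
      _ ≤ pW x κ ^ 2 * qW x κ ^ 2 := by gcongr
      _ = (κ * |x|) ^ 2 := by rw [h, mul_pow, sq_abs]
  exact (pow_le_pow_iff_left₀ (sq_nonneg _) (by positivity) two_ne_zero).mp h4

/-- `q² ≥ κ|x|`. [folklore] -/
theorem qW_sq_ge_edge (hκ : 0 < κ) (hx : x ∈ Icc (-1:ℝ) 1) : κ * |x| ≤ qW x κ ^ 2 := by
  have h := pq_sq x κ
  have hq2 : pW x κ ^ 2 ≤ qW x κ ^ 2 := by rw [qW_sq_eq]; linarith [A_pos hκ hx]
  have h4 : (κ * |x|) ^ 2 ≤ (qW x κ ^ 2) ^ 2 := by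
    calc (κ * |x|) ^ 2 = pW x κ ^ 2 * qW x κ ^ 2 := by rw [h, mul_pow, sq_abs]
      _ ≤ qW x κ ^ 2 * qW x κ ^ 2 := by gcongr
      _ = (qW x κ ^ 2) ^ 2 := by ring
  exact (pow_le_pow_iff_left₀ (by positivity) (sq_nonneg _) two_ne_zero).mp h4

/-- `q² ≥ 1 - x² + κ²`. [folklore] -/
theorem qW_sq_ge_A (x κ : ℝ) : 1 - x ^ 2 + κ ^ 2 ≤ qW x κ ^ 2 := by
  rw [qW_sq_eq]; nlinarith [sq_nonneg (pW x κ)]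

/-- `D q ≤ κ² + p²`. [folklore] -/
theorem Dq_mul_qW_le (hκ : 0 < κ) (hx : x ∈ Icc (-1:ℝ) 1) :
    Dq x κ * qW x κ ≤ κ ^ 2 + pW x κ ^ 2 := by
  rw [← Dq_mul hx]
  have := Dq_nonneg hκ hx
  have := semi_nonneg x
  nlinarith

/-- Bulk bound `D·(1-x²+κ²)·q ≤ κ²(1+κ²)` (i.e. `D ≲ κ²(1-x²)^{-3/2}`). [folklore] -/
theorem Dq_bulk (hκ : 0 < κ) (hx : x ∈ Icc (-1:ℝ) 1) :
    Dq x κ * ((1 - x ^ 2 + κ ^ 2) * qW x κ) ≤ κ ^ 2 * (1 + κ ^ 2) := by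
  have hA := A_pos hκ hx
  have h1 := Dq_mul_qW_le hκ hx
  have h2 := pW_sq_le_bulk hκ hx
  have h3 : (κ ^ 2 + pW x κ ^ 2) * (1 - x ^ 2 + κ ^ 2) ≤ κ ^ 2 * (1 + κ ^ 2) := by
    rw [le_div_iff₀ hA] at h2; nlinarith
  calc Dq x κ * ((1 - x ^ 2 + κ ^ 2) * qW x κ) = (Dq x κ * qW x κ) * (1 - x ^ 2 + κ ^ 2) := by ring
    _ ≤ (κ ^ 2 + pW x κ ^ 2) * (1 - x ^ 2 + κ ^ 2) := by gcongr
    _ ≤ κ ^ 2 * (1 + κ ^ 2) := h3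

/-- Edge bound `D q ≤ κ² + κ|x|` (so `D ≲ √κ` where `q² ≥ κ|x| ≈ κ`). [folklore] -/
theorem Dq_edge (hκ : 0 < κ) (hx : x ∈ Icc (-1:ℝ) 1) :
    Dq x κ * qW x κ ≤ κ ^ 2 + κ * |x| := by
  linarith [Dq_mul_qW_le hκ hx, pW_sq_le_edge hκ hx]

end pq


/-! ### The barrier inequality `D ≤ 4π√κ (1 - T_κ1)` and the two-sided bound on solutions -/

/-- `arctan t ≥ t/(1+t²)` for `t ≥ 0` (from `arctan t = ∫₀ᵗ ds/(1+s²)`). [folklore] -/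
theorem div_le_arctan {t : ℝ} (ht : 0 ≤ t) : t / (1 + t ^ 2) ≤ arctan t := by
  have h := integral_inv_one_add_sq (a := (0:ℝ)) (b := t)
  rw [arctan_zero, sub_zero] at h
  rw [← h]
  have hint : IntervalIntegrable (fun x : ℝ => (1 + x ^ 2)⁻¹) volume 0 t :=
    (Continuous.inv₀ (by fun_prop) (fun x => by positivity)).intervalIntegrable _ _
  calc t / (1 + t ^ 2) = ∫ _ in (0:ℝ)..t, (1 + t ^ 2)⁻¹ := by
        rw [intervalIntegral.integral_const]; simp; ring
    _ ≤ ∫ x in (0:ℝ)..t, (1 + x ^ 2)⁻¹ := by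
        refine intervalIntegral.integral_mono_on ht intervalIntegrable_const hint (fun x hx => ?_)
        rcases hx with ⟨h0, h1⟩
        gcongr

/-- `1 - T_κ1` near the edges: if `1 - |x| ≤ κ` then `1 - T_κ1(x) ≥ 1/4`. [folklore] -/
theorem one_sub_loveOp_one_edge {κ x : ℝ} (hκ : 0 < κ) (hs : 1 - |x| ≤ κ) :
    1 / 4 ≤ 1 - loveOp κ (fun _ => 1) x := by
  rw [loveOp_one hκ.ne']
  have hπ := Real.pi_pos
  have key : arctan ((1 - x) / κ) + arctan ((1 + x) / κ) ≤ 3 * π / 4 := by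
    rcases le_or_gt 0 x with h0 | h0
    · rw [abs_of_nonneg h0] at hs
      have h1 : arctan ((1 - x) / κ) ≤ π / 4 := by
        rw [← arctan_one]; exact arctan_mono ((div_le_one hκ).mpr hs)
      have h2 := arctan_lt_pi_div_two ((1 + x) / κ)
      linarith
    · rw [abs_of_neg h0] at hs
      have h1 : arctan ((1 + x) / κ) ≤ π / 4 := by
        rw [← arctan_one]; exact arctan_mono ((div_le_one hκ).mpr (by linarith))
      have h2 := arctan_lt_pi_div_two ((1 - x) / κ)
      linarith
  rw [le_sub_iff_add_le, ← le_sub_iff_add_le', div_le_iff₀ hπ]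
  linarith

/-- `1 - T_κ1` in the bulk: if `κ ≤ 1 - |x|` then `1 - T_κ1(x) ≥ κ/(2π(1-|x|))`. [folklore] -/
theorem one_sub_loveOp_one_bulk {κ x : ℝ} (hκ : 0 < κ) (hs : κ ≤ 1 - |x|) :
    κ / (2 * π * (1 - |x|)) ≤ 1 - loveOp κ (fun _ => 1) x := by
  rw [loveOp_one hκ.ne']
  have hπ := Real.pi_pos
  have hs0 : 0 < 1 - |x| := lt_of_lt_of_le hκ hs
  -- the arctan of the nearer edge
  have harc : κ / (2 * (1 - |x|)) ≤ π / 2 - arctan ((1 - |x|) / κ) := by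
    have h1 : π / 2 - arctan ((1 - |x|) / κ) = arctan (κ / (1 - |x|)) := by
      rw [show κ / (1 - |x|) = ((1 - |x|) / κ)⁻¹ by field_simp,
        arctan_inv_of_pos (by positivity)]
    rw [h1]
    have h2 := div_le_arctan (t := κ / (1 - |x|)) (by positivity)
    refine le_trans ?_ h2
    have ht1 : κ / (1 - |x|) ≤ 1 := (div_le_one hs0).mpr hs
    have ht0 : 0 ≤ κ / (1 - |x|) := by positivity
    rw [div_le_div_iff₀ (by positivity) (by positivity)]
    have : (κ / (1 - |x|)) ^ 2 ≤ 1 := by nlinarith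
    have htk : κ / (1 - |x|) * (1 - |x|) = κ := div_mul_cancel₀ κ hs0.ne'
    nlinarith [htk, this, hκ]
  have key : arctan ((1 - x) / κ) + arctan ((1 + x) / κ) ≤ π - κ / (2 * (1 - |x|)) := by
    rcases le_or_gt 0 x with h0 | h0
    · rw [abs_of_nonneg h0] at harc ⊢
      have h2 := arctan_lt_pi_div_two ((1 + x) / κ)
      linarith
    · rw [abs_of_neg h0] at harc ⊢
      have h2 := arctan_lt_pi_div_two ((1 - x) / κ)
      rw [show 1 - -x = 1 + x by ring] at harc ⊢
      linarith
  rw [le_sub_iff_add_le, ← le_sub_iff_add_le', div_le_iff₀ hπ]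
  have : κ / (2 * π * (1 - |x|)) * π = κ / (2 * (1 - |x|)) := by field_simp
  linarith

/-- **The barrier inequality.** For `0 < κ ≤ 1/4` and `x ∈ [-1,1]`:
`D(x) ≤ 4π√κ (1 - T_κ1(x))`. [folklore] -/
theorem Dq_le_barrier {κ x : ℝ} (hκ : 0 < κ) (hκ1 : κ ≤ 1 / 4) (hx : x ∈ Icc (-1:ℝ) 1) :
    Dq x κ ≤ 4 * π * √κ * (1 - loveOp κ (fun _ => 1) x) := by
  have hπ := Real.pi_pos
  have hπ3 := Real.pi_gt_three
  have hq := qW_pos x hκ.ne'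
  have hD := Dq_nonneg hκ hx
  have hsk : 0 < √κ := Real.sqrt_pos.mpr hκ
  have hsk2 : √κ ^ 2 = κ := Real.sq_sqrt hκ.le
  have habs : |x| ≤ 1 := abs_le.mpr ⟨hx.1, hx.2⟩
  rcases le_or_gt (1 - |x|) κ with hs | hs
  · -- edge case
    have hT := one_sub_loveOp_one_edge hκ hs
    have h1 : Dq x κ * qW x κ ≤ 5 / 4 * κ := by
      have := Dq_edge hκ hx
      nlinarith
    have h2 : 4 / 5 * √κ ≤ qW x κ := by
      have hq2 := qW_sq_ge_edge hκ hx
      have : (4 / 5 * √κ) ^ 2 ≤ qW x κ ^ 2 := by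
        rw [mul_pow, hsk2]; nlinarith
      exact (pow_le_pow_iff_left₀ (by positivity) hq.le two_ne_zero).mp this
    -- `D ≤ (25/16)√κ ≤ π √κ ≤ 4π√κ (1 - T1)`
    have h3 : Dq x κ ≤ 25 / 16 * √κ := by
      by_contra! hcon
      have : 25 / 16 * √κ * (4 / 5 * √κ) < Dq x κ * qW x κ :=
        calc 25 / 16 * √κ * (4 / 5 * √κ) ≤ 25 / 16 * √κ * qW x κ := by gcongr
          _ < Dq x κ * qW x κ := by gcongr
      nlinarith
    calc Dq x κ ≤ 25 / 16 * √κ := h3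
      _ ≤ 4 * π * √κ * (1 / 4) := by nlinarith
      _ ≤ 4 * π * √κ * (1 - loveOp κ (fun _ => 1) x) := by gcongr
  · -- bulk case
    have hT := one_sub_loveOp_one_bulk hκ hs.le
    have hs0 : 0 < 1 - |x| := lt_trans hκ hs
    set A := 1 - x ^ 2 + κ ^ 2 with hA
    have hApos : 0 < A := A_pos hκ hx
    have hAs : 1 - |x| ≤ A := by
      have : x ^ 2 ≤ |x| := by rw [← sq_abs]; nlinarith [abs_nonneg x]
      rw [hA]; nlinarith [sq_nonneg κ]
    have hqs : √κ ≤ qW x κ := by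
      have h1 : κ ≤ qW x κ ^ 2 := le_trans (by linarith) (qW_sq_ge_A x κ)
      calc √κ ≤ √(qW x κ ^ 2) := Real.sqrt_le_sqrt h1
        _ = qW x κ := Real.sqrt_sq hq.le
    have hbulk := Dq_bulk hκ hx
    -- `D A q ≤ κ²(1+κ²) ≤ (17/16) κ²` and `A q ≥ (1-|x|) √κ`
    have h1 : Dq x κ * (A * qW x κ) ≤ 17 / 16 * κ ^ 2 := by
      refine le_trans hbulk ?_
      have hk2 : κ ^ 2 ≤ 1 / 16 := by nlinarith
      nlinarith [hk2, sq_nonneg κ]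
    have h2 : (1 - |x|) * √κ ≤ A * qW x κ := by gcongr
    have h3 : Dq x κ * ((1 - |x|) * √κ) ≤ 17 / 16 * κ ^ 2 :=
      le_trans (by gcongr) h1
    -- hence `D ≤ (17/16) κ √κ/(1-|x|) ≤ 2 κ √κ /(1 - |x|) ≤ 4π√κ · κ/(2π(1-|x|))`
    have h4 : Dq x κ ≤ 2 * κ * √κ / (1 - |x|) := by
      rw [le_div_iff₀ hs0]
      by_contra! hcon
      have : 2 * κ * √κ * √κ < Dq x κ * (1 - |x|) * √κ := by gcongr
      nlinarith
    calc Dq x κ ≤ 2 * κ * √κ / (1 - |x|) := h4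
      _ = 4 * π * √κ * (κ / (2 * π * (1 - |x|))) := by field_simp; ring
      _ ≤ 4 * π * √κ * (1 - loveOp κ (fun _ => 1) x) := by gcongr

/-- **Lower barrier.** Every solution dominates the semicircle: `G₀ ≤ g` on `[-1,1]`. [folklore] -/
theorem IsLoveSolution.G0_le {κ : ℝ} {g : ℝ → ℝ} (hg : IsLoveSolution κ g) :
    ∀ x ∈ Icc (-1:ℝ) 1, G0 κ x ≤ g x := by
  have hκ := hg.pos
  refine le_of_sub_loveOp_le hκ (continuous_G0 κ).continuousOn hg.continuousOn (fun x hx => ?_)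
  rw [G0_sub_loveOp x hκ, hg.eq x hx]
  have := Dq_nonneg hκ hx
  have : 0 ≤ Dq x κ / (2 * π * κ) := by positivity
  linarith

/-- **Upper barrier.** For `κ ≤ 1/4`, every solution satisfies `g ≤ G₀ + 2/√κ` on `[-1,1]`.
[folklore] -/
theorem IsLoveSolution.le_G0_add {κ : ℝ} {g : ℝ → ℝ} (hg : IsLoveSolution κ g) (hκ1 : κ ≤ 1 / 4) :
    ∀ x ∈ Icc (-1:ℝ) 1, g x ≤ G0 κ x + 2 / √κ := by
  have hκ := hg.pos
  have hsk : 0 < √κ := Real.sqrt_pos.mpr hκ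
  refine le_of_sub_loveOp_le hκ hg.continuousOn ((continuous_G0 κ).continuousOn.add
    continuousOn_const) (fun x hx => ?_)
  rw [hg.eq x hx, loveOp_add hκ.ne' (continuous_G0 κ).continuousOn continuousOn_const,
    show loveOp κ (fun _ => 2 / √κ) x = 2 / √κ * loveOp κ (fun _ => 1) x by
      rw [← loveOp_const_mul]; simp]
  have hG := G0_sub_loveOp x hκ
  have hB := Dq_le_barrier hκ hκ1 hx
  -- need: D/(2πκ) ≤ (2/√κ)(1 - T1)
  have hkey : Dq x κ / (2 * π * κ) ≤ 2 / √κ * (1 - loveOp κ (fun _ => 1) x) := by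
    rw [div_le_iff₀ (by positivity)]
    calc Dq x κ ≤ 4 * π * √κ * (1 - loveOp κ (fun _ => 1) x) := hB
      _ = 2 / √κ * (1 - loveOp κ (fun _ => 1) x) * (2 * π * κ) := by
        have hk : κ = √κ ^ 2 := (Real.sq_sqrt hκ.le).symm
        rw [show (2:ℝ) * π * κ = 2 * π * √κ ^ 2 by rw [← hk]]
        field_simp
        ring
  linarith


/-! ## Part D. Symmetry of `T_κ` and the duality identities -/

/-- `T_κ` is symmetric on `C[-1,1]`: `∫ (T_κu) v = ∫ u (T_κ v)`. [folklore] -/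
theorem loveOp_symm {κ : ℝ} (hκ : κ ≠ 0) {u v : ℝ → ℝ} (hu : ContinuousOn u (Icc (-1) 1))
    (hv : ContinuousOn v (Icc (-1) 1)) :
    ∫ x in (-1:ℝ)..1, loveOp κ u x * v x = ∫ y in (-1:ℝ)..1, u y * loveOp κ v y := by
  unfold loveOp
  have hF : ContinuousOn (fun p : ℝ × ℝ => loveKernel κ p.1 p.2 * u p.2 * v p.1)
      (Icc (-1:ℝ) 1 ×ˢ Icc (-1:ℝ) 1) := by
    refine ContinuousOn.mul (ContinuousOn.mul (continuous_loveKernel_uncurry hκ).continuousOn ?_) ?_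
    · exact hu.comp continuousOn_snd (fun p hp => hp.2)
    · exact hv.comp continuousOn_fst (fun p hp => hp.1)
  have hint : IntegrableOn (Function.uncurry fun x y => loveKernel κ x y * u y * v x)
      (Set.uIoc (-1:ℝ) 1 ×ˢ Set.uIoc (-1:ℝ) 1) := by
    have h := ContinuousOn.integrableOn_compact (μ := volume)
      (isCompact_Icc.prod isCompact_Icc) hF
    refine h.mono_set ?_
    rw [Set.uIoc_of_le (by norm_num)]
    exact Set.prod_mono Ioc_subset_Icc_self Ioc_subset_Icc_self
  have hswap := MeasureTheory.intervalIntegral_intervalIntegral_swap hint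
  calc ∫ x in (-1:ℝ)..1, (∫ y in (-1:ℝ)..1, loveKernel κ x y * u y) * v x
      = ∫ x in (-1:ℝ)..1, ∫ y in (-1:ℝ)..1, loveKernel κ x y * u y * v x := by
        congr 1; ext x
        rw [← intervalIntegral.integral_mul_const]
    _ = ∫ y in (-1:ℝ)..1, ∫ x in (-1:ℝ)..1, loveKernel κ x y * u y * v x := hswap
    _ = ∫ y in (-1:ℝ)..1, u y * ∫ x in (-1:ℝ)..1, loveKernel κ y x * v x := by
        congr 1; ext y
        rw [← intervalIntegral.integral_const_mul]
        congr 1; ext x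
        rw [loveKernel_symm κ x y]; ring

/-- `T_κ φ` is continuous for continuous `φ`. [folklore] -/
theorem continuous_loveOp {κ : ℝ} (hκ : κ ≠ 0) {φ : ℝ → ℝ} (hφ : Continuous φ) :
    Continuous (loveOp κ φ) := by
  unfold loveOp
  exact intervalIntegral.continuous_parametric_intervalIntegral_of_continuous'
    (f := fun x y => loveKernel κ x y * φ y)
    ((continuous_loveKernel_uncurry hκ).mul (hφ.comp continuous_snd)) (-1) 1

/-- **Duality.** For a solution `g` and a continuous test function `φ`:
`∫ ((I - T_κ)φ) g = (1/2π) ∫ φ`. [folklore] -/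
theorem IsLoveSolution.duality {κ : ℝ} {g : ℝ → ℝ} (hg : IsLoveSolution κ g) {φ : ℝ → ℝ}
    (hφc : Continuous φ) :
    ∫ x in (-1:ℝ)..1, (φ x - loveOp κ φ x) * g x = 1 / (2 * π) * ∫ x in (-1:ℝ)..1, φ x := by
  have hκ := hg.pos
  have hφ : ContinuousOn φ (Icc (-1) 1) := hφc.continuousOn
  have hsymm := loveOp_symm hκ.ne' hφ hg.continuousOn
  have hTφ : ContinuousOn (loveOp κ φ) (Icc (-1) 1) := (continuous_loveOp hκ.ne' hφc).continuousOn
  have hTg : ContinuousOn (loveOp κ g) (Icc (-1) 1) := by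
    have : ∀ x ∈ Icc (-1:ℝ) 1, loveOp κ g x = g x - 1 / (2 * π) := by
      intro x hx; have := hg.eq x hx; linarith
    exact (hg.continuousOn.sub continuousOn_const).congr (fun x hx => this x hx)
  have i1 : IntervalIntegrable (fun x => φ x * g x) volume (-1) 1 := by
    refine ContinuousOn.intervalIntegrable ?_
    rw [uIcc_of_le (by norm_num)]; exact hφ.mul hg.continuousOn
  have i2 : IntervalIntegrable (fun x => loveOp κ φ x * g x) volume (-1) 1 := by
    refine ContinuousOn.intervalIntegrable ?_
    rw [uIcc_of_le (by norm_num)]; exact hTφ.mul hg.continuousOn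
  have i3 : IntervalIntegrable (fun x => φ x * loveOp κ g x) volume (-1) 1 := by
    refine ContinuousOn.intervalIntegrable ?_
    rw [uIcc_of_le (by norm_num)]; exact hφ.mul hTg
  calc ∫ x in (-1:ℝ)..1, (φ x - loveOp κ φ x) * g x
      = ∫ x in (-1:ℝ)..1, (φ x * g x - loveOp κ φ x * g x) := by
        congr 1; ext x; ring
    _ = (∫ x in (-1:ℝ)..1, φ x * g x) - ∫ x in (-1:ℝ)..1, φ x * loveOp κ g x := by
        rw [intervalIntegral.integral_sub i1 i2, hsymm]
    _ = ∫ x in (-1:ℝ)..1, φ x * (g x - loveOp κ g x) := by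
        rw [← intervalIntegral.integral_sub i1 i3]
        congr 1; ext x; ring
    _ = ∫ x in (-1:ℝ)..1, 1 / (2 * π) * φ x := by
        refine intervalIntegral.integral_congr (fun x hx => ?_)
        rw [uIcc_of_le (by norm_num)] at hx
        simp only [hg.eq x hx]; ring
    _ = 1 / (2 * π) * ∫ x in (-1:ℝ)..1, φ x := intervalIntegral.integral_const_mul _ _

/-- The zeroth-moment identity: `∫ g = 1/(4κ) + ∫ (D/κ) g`. [folklore] -/
theorem IsLoveSolution.integral_eq {κ : ℝ} {g : ℝ → ℝ} (hg : IsLoveSolution κ g) :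
    ∫ x in (-1:ℝ)..1, g x = 1 / (4 * κ) + ∫ x in (-1:ℝ)..1, Dq x κ / κ * g x := by
  have hκ := hg.pos
  have hdual := hg.duality (φ := fun y => semi y / κ) (continuous_semi.div_const _)
  have hpt : ∀ x : ℝ, (semi x / κ - loveOp κ (fun y => semi y / κ) x) = 1 - Dq x κ / κ := by
    intro x
    have : loveOp κ (fun y => semi y / κ) x = κ⁻¹ * loveOp κ semi x := by
      rw [← loveOp_const_mul]; congr 1; ext y; ring
    rw [this, loveOp_semi x hκ]
    unfold Dq
    field_simp
    ring
  simp only [hpt] at hdual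
  rw [intervalIntegral.integral_div, integral_semi] at hdual
  have i0 : IntervalIntegrable g volume (-1) 1 := by
    refine ContinuousOn.intervalIntegrable ?_
    rw [uIcc_of_le (by norm_num)]; exact hg.continuousOn
  have hDc : Continuous fun x => Dq x κ / κ := by
    unfold Dq qW Wc wc zc
    refine Continuous.div_const (Continuous.sub ?_ continuous_semi) _
    refine Complex.continuous_re.comp ?_
    refine Continuous.cpow ?_ continuous_const (fun x => wc_mem_slitPlane x hκ.ne')
    fun_prop
  have i1 : IntervalIntegrable (fun x => Dq x κ / κ * g x) volume (-1) 1 := by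
    refine ContinuousOn.intervalIntegrable ?_
    rw [uIcc_of_le (by norm_num)]; exact hDc.continuousOn.mul hg.continuousOn
  have hsplit : ∫ x in (-1:ℝ)..1, (1 - Dq x κ / κ) * g x =
      (∫ x in (-1:ℝ)..1, g x) - ∫ x in (-1:ℝ)..1, Dq x κ / κ * g x := by
    rw [← intervalIntegral.integral_sub i0 i1]
    congr 1; ext x; ring
  rw [hsplit] at hdual
  have : 1 / (2 * π) * (π / 2 / κ) = 1 / (4 * κ) := by field_simp; ring
  linarith


/-! ### Continuity of the closed-form quantities in `x` -/

/-- Continuity of `x ↦ W`. [folklore] -/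
theorem continuous_Wc {κ : ℝ} (hκ : κ ≠ 0) : Continuous fun x => Wc x κ := by
  unfold Wc wc zc
  refine Continuous.cpow ?_ continuous_const (fun x => wc_mem_slitPlane x hκ)
  fun_prop

/-- Continuity of `x ↦ q`. [folklore] -/
theorem continuous_qW {κ : ℝ} (hκ : κ ≠ 0) : Continuous fun x => qW x κ :=
  Complex.continuous_re.comp (continuous_Wc hκ)

/-- Continuity of `x ↦ p`. [folklore] -/
theorem continuous_pW {κ : ℝ} (hκ : κ ≠ 0) : Continuous fun x => pW x κ :=
  (Complex.continuous_im.comp (continuous_Wc hκ)).neg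

/-- Continuity of `x ↦ D`. [folklore] -/
theorem continuous_Dq {κ : ℝ} (hκ : κ ≠ 0) : Continuous fun x => Dq x κ :=
  (continuous_qW hκ).sub continuous_semi

/-- Continuity of `r₀`. [folklore] -/
theorem continuous_r0 {κ : ℝ} (hκ : κ ≠ 0) : Continuous (r0 κ) := by
  unfold r0
  have := continuous_qW hκ
  have := continuous_pW hκ
  have := continuous_semi
  fun_prop

/-! ### The second moment of the semicircle and the `w`-identity -/

/-- `∫_{-1}^{1} y²√(1-y²) dy = π/8`. [folklore] -/
theorem integral_sq_mul_semi : ∫ y in (-1:ℝ)..1, y ^ 2 * semi y = π / 8 := by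
  -- antiderivative `(y(2y²-1)√(1-y²) + arcsin y)/8`
  set F : ℝ → ℝ := fun y => (y * (2 * y ^ 2 - 1) * semi y + arcsin y) / 8 with hF
  have hderiv : ∀ y ∈ Ioo (-1:ℝ) 1, HasDerivAt F (y ^ 2 * semi y) y := by
    intro y hy
    have hpos : 0 < 1 - y ^ 2 := by rcases hy with ⟨h1, h2⟩; nlinarith
    have hs : 0 < semi y := Real.sqrt_pos.mpr hpos
    have hss : semi y * semi y = 1 - y ^ 2 := Real.mul_self_sqrt hpos.le
    have hu : HasDerivAt (fun y : ℝ => 1 - y ^ 2) (-(2 * y)) y := by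
      simpa using ((hasDerivAt_id y).pow 2).const_sub (1:ℝ)
    have hsemi : HasDerivAt semi (1 / (2 * √(1 - y ^ 2)) * (-(2 * y))) y := by
      unfold semi; exact (Real.hasDerivAt_sqrt hpos.ne').comp y hu
    have hpoly : HasDerivAt (fun y : ℝ => y * (2 * y ^ 2 - 1))
        (1 * (2 * y ^ 2 - 1) + y * (2 * (2 * y))) y := by
      have h1 : HasDerivAt (fun y : ℝ => 2 * y ^ 2 - 1) (2 * (2 * y)) y := by
        simpa using (((hasDerivAt_id y).pow 2).const_mul (2:ℝ)).sub_const (1:ℝ)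
      exact (hasDerivAt_id y).mul h1
    have harc : HasDerivAt arcsin (1 / √(1 - y ^ 2)) y :=
      Real.hasDerivAt_arcsin (by rcases hy with ⟨h1, _⟩; exact ne_of_gt h1)
        (by rcases hy with ⟨_, h2⟩; exact ne_of_lt h2)
    have hall := ((hpoly.mul hsemi).add harc).div_const 8
    refine HasDerivAt.congr_deriv (f := F) (by simpa [hF] using hall) ?_
    simp only [semi] at hss hs ⊢
    field_simp
    nlinarith [hss]
  have hcont : ContinuousOn F (Icc (-1) 1) := by
    simp only [hF]
    refine Continuous.continuousOn ?_
    have := continuous_semi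
    have := Real.continuous_arcsin
    fun_prop
  have hint : IntervalIntegrable (fun y => y ^ 2 * semi y) volume (-1) 1 :=
    ((continuous_pow 2).mul continuous_semi).intervalIntegrable _ _
  rw [intervalIntegral.integral_eq_sub_of_hasDerivAt_of_le (by norm_num) hcont hderiv hint]
  simp [hF, semi, Real.arcsin_one, Real.arcsin_neg]
  ring

/-- Duality for the subsolution `G₀`: `∫ ((I-T_κ)φ) G₀ = (1/2π)∫φ - (1/(2πκ)) ∫ φ D`. [folklore] -/
theorem duality_G0 {κ : ℝ} (hκ : 0 < κ) {φ : ℝ → ℝ} (hφc : Continuous φ) :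
    ∫ x in (-1:ℝ)..1, (φ x - loveOp κ φ x) * G0 κ x =
      1 / (2 * π) * (∫ x in (-1:ℝ)..1, φ x) - 1 / (2 * π * κ) * ∫ x in (-1:ℝ)..1, φ x * Dq x κ := by
  have hφ : ContinuousOn φ (Icc (-1) 1) := hφc.continuousOn
  have hsymm := loveOp_symm hκ.ne' hφ (continuous_G0 κ).continuousOn
  have hTφ := continuous_loveOp hκ.ne' hφc
  have hTG : Continuous (loveOp κ (G0 κ)) := continuous_loveOp hκ.ne' (continuous_G0 κ)
  have i1 : IntervalIntegrable (fun x => φ x * G0 κ x) volume (-1) 1 :=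
    (hφc.mul (continuous_G0 κ)).intervalIntegrable _ _
  have i2 : IntervalIntegrable (fun x => loveOp κ φ x * G0 κ x) volume (-1) 1 :=
    (hTφ.mul (continuous_G0 κ)).intervalIntegrable _ _
  have i3 : IntervalIntegrable (fun x => φ x * loveOp κ (G0 κ) x) volume (-1) 1 :=
    (hφc.mul hTG).intervalIntegrable _ _
  have i4 : IntervalIntegrable (fun x => 1 / (2 * π) * φ x) volume (-1) 1 :=
    (continuous_const.mul hφc).intervalIntegrable _ _
  have i5 : IntervalIntegrable (fun x => 1 / (2 * π * κ) * (φ x * Dq x κ)) volume (-1) 1 :=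
    (continuous_const.mul (hφc.mul (continuous_Dq hκ.ne'))).intervalIntegrable _ _
  calc ∫ x in (-1:ℝ)..1, (φ x - loveOp κ φ x) * G0 κ x
      = ∫ x in (-1:ℝ)..1, (φ x * G0 κ x - loveOp κ φ x * G0 κ x) := by
        congr 1; ext x; ring
    _ = (∫ x in (-1:ℝ)..1, φ x * G0 κ x) - ∫ x in (-1:ℝ)..1, φ x * loveOp κ (G0 κ) x := by
        rw [intervalIntegral.integral_sub i1 i2, hsymm]
    _ = ∫ x in (-1:ℝ)..1, φ x * (G0 κ x - loveOp κ (G0 κ) x) := by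
        rw [← intervalIntegral.integral_sub i1 i3]
        congr 1; ext x; ring
    _ = ∫ x in (-1:ℝ)..1, (1 / (2 * π) * φ x - 1 / (2 * π * κ) * (φ x * Dq x κ)) := by
        congr 1; ext x
        rw [G0_sub_loveOp x hκ]; ring
    _ = 1 / (2 * π) * (∫ x in (-1:ℝ)..1, φ x) - 1 / (2 * π * κ) * ∫ x in (-1:ℝ)..1, φ x * Dq x κ :=
        by
        rw [intervalIntegral.integral_sub i4 i5, intervalIntegral.integral_const_mul,
          intervalIntegral.integral_const_mul]

/-- The `w`-identity (`w = 1 - 2x²`): `∫ w g = 1/(8κ) + (1/(2πκ))∫ ψ₀ D + ∫ r₀ (g - G₀)`.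
[folklore] -/
theorem IsLoveSolution.integral_w_eq {κ : ℝ} {g : ℝ → ℝ} (hg : IsLoveSolution κ g) :
    ∫ x in (-1:ℝ)..1, (1 - 2 * x ^ 2) * g x =
      1 / (8 * κ) + 1 / (2 * π * κ) * (∫ x in (-1:ℝ)..1, psi0 κ x * Dq x κ)
        + ∫ x in (-1:ℝ)..1, r0 κ x * (g x - G0 κ x) := by
  have hκ := hg.pos
  have hπ := Real.pi_pos
  have hgc := hg.continuousOn
  have E1 := hg.duality (continuous_psi0 κ)
  have E2 := duality_G0 hκ (continuous_psi0 κ)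
  simp only [psi0_sub_loveOp _ hκ] at E1 E2
  -- integrability facts
  have hwc : Continuous fun x : ℝ => 1 - 2 * x ^ 2 := by fun_prop
  have hr := continuous_r0 hκ.ne'
  have ig : IntervalIntegrable g volume (-1) 1 := by
    refine ContinuousOn.intervalIntegrable ?_; rw [uIcc_of_le (by norm_num)]; exact hgc
  have iwg : IntervalIntegrable (fun x => (1 - 2 * x ^ 2) * g x) volume (-1) 1 := by
    refine ContinuousOn.intervalIntegrable ?_; rw [uIcc_of_le (by norm_num)]
    exact hwc.continuousOn.mul hgc
  have irg : IntervalIntegrable (fun x => r0 κ x * g x) volume (-1) 1 := by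
    refine ContinuousOn.intervalIntegrable ?_; rw [uIcc_of_le (by norm_num)]
    exact hr.continuousOn.mul hgc
  have iwG : IntervalIntegrable (fun x => (1 - 2 * x ^ 2) * G0 κ x) volume (-1) 1 :=
    (hwc.mul (continuous_G0 κ)).intervalIntegrable _ _
  have irG : IntervalIntegrable (fun x => r0 κ x * G0 κ x) volume (-1) 1 :=
    (hr.mul (continuous_G0 κ)).intervalIntegrable _ _
  -- split E1 and E2
  have E1' : (∫ x in (-1:ℝ)..1, (1 - 2 * x ^ 2) * g x) - ∫ x in (-1:ℝ)..1, r0 κ x * g x =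
      1 / (2 * π) * ∫ x in (-1:ℝ)..1, psi0 κ x := by
    rw [← E1, ← intervalIntegral.integral_sub iwg irg]
    congr 1; ext x; ring
  have E2' : (∫ x in (-1:ℝ)..1, (1 - 2 * x ^ 2) * G0 κ x) - ∫ x in (-1:ℝ)..1, r0 κ x * G0 κ x =
      1 / (2 * π) * (∫ x in (-1:ℝ)..1, psi0 κ x)
        - 1 / (2 * π * κ) * ∫ x in (-1:ℝ)..1, psi0 κ x * Dq x κ := by
    rw [← E2, ← intervalIntegral.integral_sub iwG irG]
    congr 1; ext x; ring
  -- the explicit moment `∫ w G₀ = 1/(8κ)`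
  have E3 : ∫ x in (-1:ℝ)..1, (1 - 2 * x ^ 2) * G0 κ x = 1 / (8 * κ) := by
    have i1 : IntervalIntegrable (fun x => semi x) volume (-1) 1 :=
      continuous_semi.intervalIntegrable _ _
    have i2 : IntervalIntegrable (fun x => x ^ 2 * semi x) volume (-1) 1 :=
      ((continuous_pow 2).mul continuous_semi).intervalIntegrable _ _
    calc ∫ x in (-1:ℝ)..1, (1 - 2 * x ^ 2) * G0 κ x
        = ∫ x in (-1:ℝ)..1, (1 / (2 * π * κ)) * (semi x - 2 * (x ^ 2 * semi x)) := by
          congr 1; ext x; unfold G0; ring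
      _ = 1 / (8 * κ) := by
          rw [intervalIntegral.integral_const_mul,
            intervalIntegral.integral_sub i1 (i2.const_mul _),
            intervalIntegral.integral_const_mul, integral_semi, integral_sq_mul_semi]
          field_simp; ring
  have E4 : ∫ x in (-1:ℝ)..1, r0 κ x * (g x - G0 κ x) =
      (∫ x in (-1:ℝ)..1, r0 κ x * g x) - ∫ x in (-1:ℝ)..1, r0 κ x * G0 κ x := by
    rw [← intervalIntegral.integral_sub irg irG]; congr 1; ext x; ring
  linarith [E1', E2', E3, E4]


/-! ## Part E. Estimates

All pointwise bounds are expressed through the weight `ω(x) = 1 - |x| + κ` (edge distance plus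
`κ`); the only integral needed is `∫_{-1}^{1} dx/ω = 2 log((1+κ)/κ)`. -/

/-- The weight `ω = 1 - |x| + κ`. [folklore] -/
def omega (κ x : ℝ) : ℝ := 1 - |x| + κ

section pointwise
variable {κ x : ℝ}

/-- `ω > 0` on `[-1,1]`. [folklore] -/
theorem omega_pos (hκ : 0 < κ) (hx : x ∈ Icc (-1:ℝ) 1) : 0 < omega κ x := by
  unfold omega; have := abs_le.mpr ⟨hx.1, hx.2⟩; linarith

/-- `κ ≤ ω` on `[-1,1]`. [folklore] -/
theorem le_omega (hx : x ∈ Icc (-1:ℝ) 1) : κ ≤ omega κ x := by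
  unfold omega; have := abs_le.mpr ⟨hx.1, hx.2⟩; linarith

/-- `1 - x² ≤ 2(1 - |x|)` on `[-1,1]`. [folklore] -/
theorem one_sub_sq_le (hx : x ∈ Icc (-1:ℝ) 1) : 1 - x ^ 2 ≤ 2 * (1 - |x|) := by
  have h := abs_le.mpr ⟨hx.1, hx.2⟩
  have : x ^ 2 = |x| ^ 2 := (sq_abs x).symm
  nlinarith [abs_nonneg x]

/-- `1 - |x| ≤ 1 - x² + κ²` on `[-1,1]`. [folklore] -/
theorem one_sub_abs_le_A (hx : x ∈ Icc (-1:ℝ) 1) : 1 - |x| ≤ 1 - x ^ 2 + κ ^ 2 := by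
  have h := abs_le.mpr ⟨hx.1, hx.2⟩
  have : x ^ 2 = |x| ^ 2 := (sq_abs x).symm
  nlinarith [abs_nonneg x, sq_nonneg κ]

/-- (P1) `p² ≤ 2κ²/ω`. [folklore] -/
theorem pW_sq_le_omega (hκ : 0 < κ) (hx : x ∈ Icc (-1:ℝ) 1) :
    pW x κ ^ 2 * omega κ x ≤ 2 * κ ^ 2 := by
  have habs := abs_le.mpr ⟨hx.1, hx.2⟩
  have hω := omega_pos hκ hx
  rcases le_or_gt κ (1 - |x|) with hs | hs
  · -- bulk: p² ≤ κ²x²/A ≤ κ²/(1-|x|)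
    have hA := A_pos hκ hx
    have h1 := pW_sq_le_bulk hκ hx
    have h2 : κ ^ 2 * x ^ 2 / (1 - x ^ 2 + κ ^ 2) * (1 - |x|) ≤ κ ^ 2 := by
      rw [div_mul_eq_mul_div, div_le_iff₀ hA]
      have hx2 : x ^ 2 ≤ 1 := by nlinarith [hx.1, hx.2]
      have := one_sub_abs_le_A (κ := κ) hx
      have h0 : 0 ≤ 1 - |x| := by linarith
      calc κ ^ 2 * x ^ 2 * (1 - |x|) ≤ κ ^ 2 * 1 * (1 - x ^ 2 + κ ^ 2) := by
            gcongr
        _ = κ ^ 2 * (1 - x ^ 2 + κ ^ 2) := by ring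
    have h3 : pW x κ ^ 2 * (1 - |x|) ≤ κ ^ 2 := le_trans (by gcongr) h2
    unfold omega
    nlinarith [sq_nonneg (pW x κ), h3]
  · -- edge: p² ≤ κ|x| ≤ κ, ω ≤ 2κ
    have h1 := pW_sq_le_edge hκ hx
    unfold omega
    have : pW x κ ^ 2 ≤ κ := le_trans h1 (by nlinarith)
    nlinarith [sq_nonneg (pW x κ)]

/-- (P2) `D ω^{3/2} ≤ 6κ²`. [folklore] -/
theorem Dq_omega32 (hκ : 0 < κ) (hκ1 : κ ≤ 1 / 4) (hx : x ∈ Icc (-1:ℝ) 1) :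
    Dq x κ * (omega κ x * √(omega κ x)) ≤ 6 * κ ^ 2 := by
  have habs := abs_le.mpr ⟨hx.1, hx.2⟩
  have hω := omega_pos hκ hx
  have hD := Dq_nonneg hκ hx
  have hq := qW_pos x hκ.ne'
  have hsω : 0 < √(omega κ x) := Real.sqrt_pos.mpr hω
  have hsω2 : √(omega κ x) ^ 2 = omega κ x := Real.sq_sqrt hω.le
  rcases le_or_gt κ (1 - |x|) with hs | hs
  · -- bulk
    set A := 1 - x ^ 2 + κ ^ 2 with hA
    have hApos : 0 < A := A_pos hκ hx
    have hbulk : Dq x κ * (A * qW x κ) ≤ 17 / 16 * κ ^ 2 := by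
      refine le_trans (Dq_bulk hκ hx) ?_
      have hk2 : κ ^ 2 ≤ 1 / 16 := by nlinarith
      nlinarith [hk2, sq_nonneg κ]
    have hAω : omega κ x / 2 ≤ A := by
      have := one_sub_abs_le_A (κ := κ) hx
      unfold omega; rw [hA]; linarith
    have hqω : 2 / 3 * √(omega κ x) ≤ qW x κ := by
      have h1 : (2 / 3 * √(omega κ x)) ^ 2 ≤ qW x κ ^ 2 := by
        rw [mul_pow, hsω2]
        have := qW_sq_ge_A x κ
        rw [← hA] at this
        nlinarith
      exact (pow_le_pow_iff_left₀ (by positivity) hq.le two_ne_zero).mp h1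
    calc Dq x κ * (omega κ x * √(omega κ x))
        ≤ Dq x κ * ((2 * A) * (3 / 2 * qW x κ)) := by gcongr <;> linarith
      _ = 3 * (Dq x κ * (A * qW x κ)) := by ring
      _ ≤ 3 * (17 / 16 * κ ^ 2) := by gcongr
      _ ≤ 6 * κ ^ 2 := by nlinarith
  · -- edge
    have hsk : 0 < √κ := Real.sqrt_pos.mpr hκ
    have hsk2 : √κ ^ 2 = κ := Real.sq_sqrt hκ.le
    have h1 : Dq x κ * qW x κ ≤ 5 / 4 * κ := by
      have := Dq_edge hκ hx; nlinarith
    have h2 : 4 / 5 * √κ ≤ qW x κ := by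
      have hq2 := qW_sq_ge_edge hκ hx
      have : (4 / 5 * √κ) ^ 2 ≤ qW x κ ^ 2 := by rw [mul_pow, hsk2]; nlinarith
      exact (pow_le_pow_iff_left₀ (by positivity) hq.le two_ne_zero).mp this
    have h3 : Dq x κ * √κ ≤ 25 / 16 * κ := by
      calc Dq x κ * √κ ≤ Dq x κ * (5 / 4 * qW x κ) := by gcongr; linarith
        _ = 5 / 4 * (Dq x κ * qW x κ) := by ring
        _ ≤ 5 / 4 * (5 / 4 * κ) := by gcongr
        _ = 25 / 16 * κ := by ring
    have hω2 : omega κ x ≤ 2 * κ := by unfold omega; linarith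
    have hsω3 : √(omega κ x) ≤ 3 / 2 * √κ := by
      have : (√(omega κ x)) ^ 2 ≤ (3 / 2 * √κ) ^ 2 := by rw [hsω2, mul_pow, hsk2]; linarith
      exact (pow_le_pow_iff_left₀ hsω.le (by positivity) two_ne_zero).mp this
    calc Dq x κ * (omega κ x * √(omega κ x))
        ≤ Dq x κ * ((2 * κ) * (3 / 2 * √κ)) := by gcongr
      _ = 3 * κ * (Dq x κ * √κ) := by ring
      _ ≤ 3 * κ * (25 / 16 * κ) := by gcongr
      _ ≤ 6 * κ ^ 2 := by nlinarith

/-- (P2a) `D ω ≤ 6 κ √κ`. [folklore] -/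
theorem Dq_omega (hκ : 0 < κ) (hκ1 : κ ≤ 1 / 4) (hx : x ∈ Icc (-1:ℝ) 1) :
    Dq x κ * omega κ x ≤ 6 * κ * √κ := by
  have h := Dq_omega32 hκ hκ1 hx
  have hω := omega_pos hκ hx
  have hD := Dq_nonneg hκ hx
  have hsk : 0 < √κ := Real.sqrt_pos.mpr hκ
  have hsk2 : √κ * √κ = κ := Real.mul_self_sqrt hκ.le
  have hle : √κ ≤ √(omega κ x) := Real.sqrt_le_sqrt (le_omega hx)
  have : Dq x κ * omega κ x * √κ ≤ 6 * κ * √κ * √κ := by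
    calc Dq x κ * omega κ x * √κ ≤ Dq x κ * omega κ x * √(omega κ x) := by gcongr
      _ = Dq x κ * (omega κ x * √(omega κ x)) := by ring
      _ ≤ 6 * κ ^ 2 := h
      _ = 6 * κ * √κ * √κ := by rw [mul_assoc (6 * κ), hsk2]; ring
  exact le_of_mul_le_mul_right this hsk

/-- (P2b) `(1-x²) D ≤ 6κ²(1 + 1/ω)`. [folklore] -/
theorem one_sub_sq_mul_Dq (hκ : 0 < κ) (hκ1 : κ ≤ 1 / 4) (hx : x ∈ Icc (-1:ℝ) 1) :
    (1 - x ^ 2) * Dq x κ ≤ 6 * κ ^ 2 * (1 + 1 / omega κ x) := by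
  have h := Dq_omega32 hκ hκ1 hx
  have hω := omega_pos hκ hx
  have hD := Dq_nonneg hκ hx
  have hsω : 0 < √(omega κ x) := Real.sqrt_pos.mpr hω
  have hsω2 : √(omega κ x) * √(omega κ x) = omega κ x := Real.mul_self_sqrt hω.le
  -- `(1-x²) ≤ 2ω` and `2/√ω ≤ 1 + 1/ω`
  have h1 : (1 - x ^ 2) * Dq x κ ≤ 2 * omega κ x * Dq x κ := by
    have := one_sub_sq_le hx
    have : 1 - x ^ 2 ≤ 2 * omega κ x := by unfold omega; linarith
    gcongr
  have h2 : 2 * omega κ x * Dq x κ * √(omega κ x) ≤ 12 * κ ^ 2 := by nlinarith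
  have hAM : 2 * √(omega κ x) ≤ omega κ x + 1 := by
    nlinarith [sq_nonneg (√(omega κ x) - 1), hsω2]
  have h5 : 2 * omega κ x * Dq x κ * omega κ x ≤ 6 * κ ^ 2 * (omega κ x + 1) := by
    calc 2 * omega κ x * Dq x κ * omega κ x
        = (2 * omega κ x * Dq x κ * √(omega κ x)) * √(omega κ x) := by
          rw [mul_assoc _ (√(omega κ x)), hsω2]
      _ ≤ 12 * κ ^ 2 * √(omega κ x) := by gcongr
      _ = 6 * κ ^ 2 * (2 * √(omega κ x)) := by ring
      _ ≤ 6 * κ ^ 2 * (omega κ x + 1) := by gcongr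
  calc (1 - x ^ 2) * Dq x κ ≤ 2 * omega κ x * Dq x κ := h1
    _ = 2 * omega κ x * Dq x κ * omega κ x / omega κ x := by field_simp
    _ ≤ 6 * κ ^ 2 * (omega κ x + 1) / omega κ x := by gcongr
    _ = 6 * κ ^ 2 * (1 + 1 / omega κ x) := by field_simp

/-- (P2c) `(1-x²) D² ≤ 72 κ³/ω`. [folklore] -/
theorem one_sub_sq_mul_Dq_sq (hκ : 0 < κ) (hκ1 : κ ≤ 1 / 4) (hx : x ∈ Icc (-1:ℝ) 1) :
    (1 - x ^ 2) * Dq x κ ^ 2 ≤ 72 * κ ^ 3 / omega κ x := by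
  have h := Dq_omega32 hκ hκ1 hx
  have hω := omega_pos hκ hx
  have hκω := le_omega (κ := κ) hx
  have hD := Dq_nonneg hκ hx
  have hsω2 : √(omega κ x) * √(omega κ x) = omega κ x := Real.mul_self_sqrt hω.le
  have h1 : 1 - x ^ 2 ≤ 2 * omega κ x := by have := one_sub_sq_le hx; unfold omega; linarith
  -- `(D ω √ω)² ≤ 36 κ⁴`, i.e. `D² ω³ ≤ 36κ⁴`
  have h2 : (Dq x κ * (omega κ x * √(omega κ x))) ^ 2 ≤ (6 * κ ^ 2) ^ 2 :=
    pow_le_pow_left₀ (by positivity) h 2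
  have h3 : Dq x κ ^ 2 * omega κ x ^ 3 ≤ 36 * κ ^ 4 := by
    have : (Dq x κ * (omega κ x * √(omega κ x))) ^ 2 = Dq x κ ^ 2 * omega κ x ^ 3 := by
      rw [mul_pow, mul_pow, sq (√(omega κ x)), hsω2]; ring
    nlinarith [h2, this]
  rw [le_div_iff₀ hω]
  calc (1 - x ^ 2) * Dq x κ ^ 2 * omega κ x ≤ 2 * omega κ x * Dq x κ ^ 2 * omega κ x := by
        gcongr
    _ = 2 * (Dq x κ ^ 2 * omega κ x ^ 3) / omega κ x := by field_simp
    _ ≤ 2 * (36 * κ ^ 4) / omega κ x := by gcongr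
    _ ≤ 2 * (36 * κ ^ 4) / κ := by gcongr
    _ = 72 * κ ^ 3 := by field_simp; ring

/-- (P3) `D √(1-x²) ≤ κ² + 2κ²/ω`. [folklore] -/
theorem Dq_mul_semi_le (hκ : 0 < κ) (hx : x ∈ Icc (-1:ℝ) 1) :
    Dq x κ * semi x ≤ κ ^ 2 + 2 * κ ^ 2 / omega κ x := by
  have hω := omega_pos hκ hx
  have h1 : Dq x κ * semi x ≤ Dq x κ * qW x κ :=
    mul_le_mul_of_nonneg_left (semi_le_qW hκ hx) (Dq_nonneg hκ hx)
  have h2 := Dq_mul_qW_le hκ hx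
  have h3 : pW x κ ^ 2 ≤ 2 * κ ^ 2 / omega κ x := by
    rw [le_div_iff₀ hω]; exact pW_sq_le_omega hκ hx
  linarith

/-- (P4) `|p| ≤ κ(1 + 1/ω)`. [folklore] -/
theorem abs_pW_le (hκ : 0 < κ) (hx : x ∈ Icc (-1:ℝ) 1) :
    |pW x κ| ≤ κ * (1 + 1 / omega κ x) := by
  have hω := omega_pos hκ hx
  have h1 : pW x κ ^ 2 ≤ 2 * κ ^ 2 / omega κ x := by
    rw [le_div_iff₀ hω]; exact pW_sq_le_omega hκ hx
  have h2 : 2 * κ ^ 2 / omega κ x ≤ (κ * (1 + 1 / omega κ x)) ^ 2 := by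
    have : (κ * (1 + 1 / omega κ x)) ^ 2 - 2 * κ ^ 2 / omega κ x =
        κ ^ 2 * (1 + (1 / omega κ x) ^ 2) := by ring
    nlinarith [this, sq_nonneg (1 / omega κ x), sq_nonneg κ]
  have h3 : |pW x κ| ^ 2 ≤ (κ * (1 + 1 / omega κ x)) ^ 2 := by rw [sq_abs]; linarith
  exact (pow_le_pow_iff_left₀ (abs_nonneg _) (by positivity) two_ne_zero).mp h3

/-- (P5) `q ≤ 1 + D`. [folklore] -/
theorem qW_le_one_add (x κ : ℝ) : qW x κ ≤ 1 + Dq x κ := by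
  unfold Dq; linarith [semi_le_one x]

/-- (P6) `κ²x² - 9κ³/ω ≤ (1-x²)p² ≤ κ²x²`. [folklore] -/
theorem one_sub_sq_mul_pW_sq_le (hκ : 0 < κ) (hx : x ∈ Icc (-1:ℝ) 1) :
    (1 - x ^ 2) * pW x κ ^ 2 ≤ κ ^ 2 * x ^ 2 := by
  have hA := A_pos hκ hx
  have h := pW_sq_le_bulk hκ hx
  rw [le_div_iff₀ hA] at h
  have hx2 : 0 ≤ 1 - x ^ 2 := by rcases hx with ⟨h1, h2⟩; nlinarith
  nlinarith [sq_nonneg (pW x κ), sq_nonneg κ, sq_nonneg x]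

/-- (P6, lower) `κ²x² - 9κ³/ω ≤ (1-x²)p²`. [folklore] -/
theorem one_sub_sq_mul_pW_sq_ge (hκ : 0 < κ) (hκ1 : κ ≤ 1 / 4) (hx : x ∈ Icc (-1:ℝ) 1) :
    κ ^ 2 * x ^ 2 - 9 * κ ^ 3 / omega κ x ≤ (1 - x ^ 2) * pW x κ ^ 2 := by
  have habs := abs_le.mpr ⟨hx.1, hx.2⟩
  have hω := omega_pos hκ hx
  have hκω := le_omega (κ := κ) hx
  have hq := qW_pos x hκ.ne'
  have hq2 := qW_sq_eq x κ
  have hpq := pq_sq x κ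
  -- the deficit `κ²x² - (1-x²)p² = κ²x²(κ²+p²)/q²`
  have hdef : (κ ^ 2 * x ^ 2 - (1 - x ^ 2) * pW x κ ^ 2) * qW x κ ^ 2 =
      κ ^ 2 * x ^ 2 * (κ ^ 2 + pW x κ ^ 2) := by
    have : (1 - x ^ 2) * pW x κ ^ 2 * qW x κ ^ 2 = (1 - x ^ 2) * (κ ^ 2 * x ^ 2) := by
      rw [mul_assoc, hpq]
    linear_combination (κ ^ 2 * x ^ 2) * hq2 - this
  -- bound `κ²x²(κ²+p²) ≤ 9κ⁴ q²/ω`, i.e. deficit ≤ 9κ⁴/ω² ≤ 9κ³/ω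
  suffices hsuff : (κ ^ 2 * x ^ 2 - (1 - x ^ 2) * pW x κ ^ 2) * omega κ x ≤ 9 * κ ^ 3 by
    have hd : κ ^ 2 * x ^ 2 - (1 - x ^ 2) * pW x κ ^ 2 ≤ 9 * κ ^ 3 / omega κ x :=
      (le_div_iff₀ hω).mpr hsuff
    linarith
  have hx2 : x ^ 2 ≤ 1 := by nlinarith [hx.1, hx.2]
  rcases le_or_gt κ (1 - |x|) with hs | hs
  · -- bulk: p² ≤ κ²/A, q² ≥ A ≥ ω/2, A ≤ 17/16
    set A := 1 - x ^ 2 + κ ^ 2 with hA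
    have hApos : 0 < A := A_pos hκ hx
    have hAω : omega κ x / 2 ≤ A := by
      have := one_sub_abs_le_A (κ := κ) hx; unfold omega; rw [hA]; linarith
    have hAle : A ≤ 17 / 16 := by rw [hA]; nlinarith [sq_nonneg x]
    have hp : pW x κ ^ 2 * A ≤ κ ^ 2 := by
      have := pW_sq_le_bulk hκ hx
      rw [← hA, le_div_iff₀ hApos] at this; nlinarith
    have hqA : A ≤ qW x κ ^ 2 := by have := qW_sq_ge_A x κ; rwa [← hA] at this
    -- deficit * q² = κ²x²(κ²+p²) ≤ κ²(κ² + κ²/A); deficit ≤ κ⁴(1 + 1/A)/q² ≤ κ⁴(A+1)/A²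
    have hd0 : 0 ≤ κ ^ 2 * x ^ 2 - (1 - x ^ 2) * pW x κ ^ 2 := by
      linarith [one_sub_sq_mul_pW_sq_le hκ hx]
    have key : (κ ^ 2 * x ^ 2 - (1 - x ^ 2) * pW x κ ^ 2) * A ^ 2 ≤ κ ^ 4 * (A + 1) := by
      have e1 : (κ ^ 2 * x ^ 2 - (1 - x ^ 2) * pW x κ ^ 2) * A ^ 2 ≤
          (κ ^ 2 * x ^ 2 - (1 - x ^ 2) * pW x κ ^ 2) * qW x κ ^ 2 * A := by
        rw [sq A, ← mul_assoc]; gcongr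
      rw [hdef] at e1
      have e2 : κ ^ 2 * x ^ 2 * (κ ^ 2 + pW x κ ^ 2) * A ≤ κ ^ 2 * 1 * (κ ^ 2 * A + κ ^ 2) := by
        have : κ ^ 2 * x ^ 2 * (κ ^ 2 + pW x κ ^ 2) * A =
            κ ^ 2 * x ^ 2 * (κ ^ 2 * A + pW x κ ^ 2 * A) := by ring
        rw [this]; gcongr
      nlinarith [e1, e2]
    -- ω A² ≥ ... : deficit ω ≤ κ⁴(A+1) ω/A² ≤ κ⁴ (33/16) ω (4/ω²) = (33/4) κ⁴/ω ≤ 9 κ³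
    have h5 : (κ ^ 2 * x ^ 2 - (1 - x ^ 2) * pW x κ ^ 2) * omega κ x * omega κ x ^ 2 ≤
        9 * κ ^ 3 * omega κ x ^ 2 := by
      calc (κ ^ 2 * x ^ 2 - (1 - x ^ 2) * pW x κ ^ 2) * omega κ x * omega κ x ^ 2
          ≤ (κ ^ 2 * x ^ 2 - (1 - x ^ 2) * pW x κ ^ 2) * omega κ x * (2 * A) ^ 2 := by
            gcongr; linarith
        _ = 4 * omega κ x * ((κ ^ 2 * x ^ 2 - (1 - x ^ 2) * pW x κ ^ 2) * A ^ 2) := by ring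
        _ ≤ 4 * omega κ x * (κ ^ 4 * (A + 1)) := by gcongr
        _ ≤ 4 * omega κ x * (κ ^ 4 * (33 / 16)) := by gcongr; linarith
        _ = 33 / 4 * κ ^ 3 * (κ * omega κ x) := by ring
        _ ≤ 33 / 4 * κ ^ 3 * (omega κ x * omega κ x) := by gcongr
        _ ≤ 9 * κ ^ 3 * omega κ x ^ 2 := by
            have h3pos : 0 ≤ κ ^ 3 := by positivity
            nlinarith [sq_nonneg (omega κ x), mul_nonneg h3pos (sq_nonneg (omega κ x))]
    exact le_of_mul_le_mul_right h5 (by positivity)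
  · -- edge: p² ≤ κ, q² ≥ 3κ/4: deficit ≤ κ²(κ²+κ)/q² ≤ (4/3)κ(κ²+κ) ≤ (5/3)κ², ω ≤ 2κ
    have hp : pW x κ ^ 2 ≤ κ := le_trans (pW_sq_le_edge hκ hx) (by nlinarith)
    have hq34 : 3 / 4 * κ ≤ qW x κ ^ 2 := le_trans (by nlinarith) (qW_sq_ge_edge hκ hx)
    have hω2 : omega κ x ≤ 2 * κ := by unfold omega; linarith
    have e1 : (κ ^ 2 * x ^ 2 - (1 - x ^ 2) * pW x κ ^ 2) * (3 / 4 * κ) ≤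
        κ ^ 2 * 1 * (κ ^ 2 + κ) := by
      have hd0 : 0 ≤ κ ^ 2 * x ^ 2 - (1 - x ^ 2) * pW x κ ^ 2 := by
        linarith [one_sub_sq_mul_pW_sq_le hκ hx]
      calc (κ ^ 2 * x ^ 2 - (1 - x ^ 2) * pW x κ ^ 2) * (3 / 4 * κ)
          ≤ (κ ^ 2 * x ^ 2 - (1 - x ^ 2) * pW x κ ^ 2) * qW x κ ^ 2 := by gcongr
        _ = κ ^ 2 * x ^ 2 * (κ ^ 2 + pW x κ ^ 2) := hdef
        _ ≤ κ ^ 2 * 1 * (κ ^ 2 + κ) := by gcongr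
    have e2 : (κ ^ 2 * x ^ 2 - (1 - x ^ 2) * pW x κ ^ 2) ≤ 5 / 3 * κ ^ 2 := by
      have hk4 : κ ^ 3 * κ ≤ κ ^ 3 * (1 / 4) := mul_le_mul_of_nonneg_left hκ1 (by positivity)
      have : (κ ^ 2 * x ^ 2 - (1 - x ^ 2) * pW x κ ^ 2) * κ ≤ 5 / 3 * κ ^ 2 * κ := by
        nlinarith [e1, hk4]
      exact le_of_mul_le_mul_right this hκ
    calc (κ ^ 2 * x ^ 2 - (1 - x ^ 2) * pW x κ ^ 2) * omega κ x ≤ 5 / 3 * κ ^ 2 * (2 * κ) := by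
          have hd0 : 0 ≤ κ ^ 2 * x ^ 2 - (1 - x ^ 2) * pW x κ ^ 2 := by
            linarith [one_sub_sq_mul_pW_sq_le hκ hx]
          gcongr
      _ ≤ 9 * κ ^ 3 := by nlinarith

/-- The pointwise identity `2 √(1-x²) D = κ² + p² - D²`. [folklore] -/
theorem two_semi_mul_Dq (hx : x ∈ Icc (-1:ℝ) 1) :
    2 * semi x * Dq x κ = κ ^ 2 + pW x κ ^ 2 - Dq x κ ^ 2 := by
  have h := Dq_mul (κ := κ) hx
  have : qW x κ = semi x + Dq x κ := by unfold Dq; ring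
  rw [this] at h
  nlinarith [h]

/-- (P7) `|r₀| ≤ 7κ(1 + 1/ω)`. [folklore] -/
theorem abs_r0_le (hκ : 0 < κ) (hκ1 : κ ≤ 1 / 4) (hx : x ∈ Icc (-1:ℝ) 1) :
    |r0 κ x| ≤ 7 * κ * (1 + 1 / omega κ x) := by
  have habs := abs_le.mpr ⟨hx.1, hx.2⟩
  have hω := omega_pos hκ hx
  have hκω := le_omega (κ := κ) hx
  have hD := Dq_nonneg hκ hx
  have hq := qW_pos x hκ.ne'
  have h1 := one_sub_sq_mul_Dq hκ hκ1 hx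
  have h2 := abs_pW_le hκ hx
  have h3 := qW_le_one_add x κ
  have h4 : Dq x κ ≤ 1 / omega κ x := by
    rw [le_div_iff₀ hω]
    have := Dq_omega hκ hκ1 hx
    have hsk : √κ ≤ 1 / 2 := by
      rw [Real.sqrt_le_left (by norm_num)]; linarith
    nlinarith
  have hinv : 0 < 1 / omega κ x := by positivity
  -- rewrite `r₀` through `D`
  have hr : r0 κ x = 2 / (3 * κ) * ((1 - x ^ 2) * Dq x κ + κ ^ 2 * qW x κ - 2 * κ * x * pW x κ)
      - 2 / 3 * κ ^ 2 := by
    unfold r0 Dq; ring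
  rw [hr]
  have hxp : |x * pW x κ| ≤ κ * (1 + 1 / omega κ x) := by
    rw [abs_mul]
    calc |x| * |pW x κ| ≤ 1 * (κ * (1 + 1 / omega κ x)) :=
          mul_le_mul habs h2 (abs_nonneg _) (by norm_num)
      _ = κ * (1 + 1 / omega κ x) := one_mul _
  have hin : |(1 - x ^ 2) * Dq x κ + κ ^ 2 * qW x κ - 2 * κ * x * pW x κ| ≤
      9 * κ ^ 2 * (1 + 1 / omega κ x) := by
    refine abs_le.mpr ⟨?_, ?_⟩
    · have := (abs_le.mp hxp).2
      have hx2 : 0 ≤ (1 - x ^ 2) * Dq x κ := mul_nonneg (by nlinarith [hx.1, hx.2]) hD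
      nlinarith
    · have := (abs_le.mp hxp).1
      nlinarith
  calc |2 / (3 * κ) * ((1 - x ^ 2) * Dq x κ + κ ^ 2 * qW x κ - 2 * κ * x * pW x κ) - 2 / 3 * κ ^ 2|
      ≤ |2 / (3 * κ) * ((1 - x ^ 2) * Dq x κ + κ ^ 2 * qW x κ - 2 * κ * x * pW x κ)|
          + |2 / 3 * κ ^ 2| :=
        abs_sub _ _
    _ ≤ 2 / (3 * κ) * (9 * κ ^ 2 * (1 + 1 / omega κ x)) + 2 / 3 * κ ^ 2 := by
        rw [abs_mul, abs_of_pos (by positivity : (0:ℝ) < 2 / (3 * κ)),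
          abs_of_pos (by positivity : (0:ℝ) < 2 / 3 * κ ^ 2)]
        gcongr
    _ = 6 * κ * (1 + 1 / omega κ x) + 2 / 3 * κ ^ 2 := by field_simp; ring
    _ ≤ 7 * κ * (1 + 1 / omega κ x) := by nlinarith

end pointwise


/-! ### The integral of `1/ω` and the integrated bounds -/

/-- `ℓ(κ) = log((1+κ)/κ)`. [folklore] -/
def ell (κ : ℝ) : ℝ := Real.log ((1 + κ) / κ)

/-- `ℓ ≥ 0`. [folklore] -/
theorem ell_nonneg {κ : ℝ} (hκ : 0 < κ) : 0 ≤ ell κ := by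
  unfold ell
  refine Real.log_nonneg ?_
  rw [le_div_iff₀ hκ]; linarith

/-- Continuity of `1/ω` on `[-1,1]`. [folklore] -/
theorem continuousOn_inv_omega {κ : ℝ} (hκ : 0 < κ) :
    ContinuousOn (fun x => 1 / omega κ x) (Icc (-1:ℝ) 1) := by
  refine ContinuousOn.div continuousOn_const ?_ (fun x hx => (omega_pos hκ hx).ne')
  unfold omega; fun_prop

/-- `∫_{-1}^{1} dx/(1 - |x| + κ) = 2 log((1+κ)/κ)`. [folklore] -/
theorem integral_inv_omega {κ : ℝ} (hκ : 0 < κ) :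
    ∫ x in (-1:ℝ)..1, 1 / omega κ x = 2 * ell κ := by
  have hl : ∫ x in (-1:ℝ)..0, 1 / omega κ x = Real.log (1 + κ) - Real.log κ := by
    have heq : EqOn (fun x => 1 / omega κ x) (fun x => 1 / (1 + x + κ)) (uIcc (-1:ℝ) 0) := by
      intro x hx
      rw [uIcc_of_le (by norm_num)] at hx
      simp only [omega, abs_of_nonpos hx.2]
      ring
    rw [intervalIntegral.integral_congr heq]
    have hderiv : ∀ x ∈ uIcc (-1:ℝ) 0,
        HasDerivAt (fun x => Real.log (1 + x + κ)) (1 / (1 + x + κ)) x := by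
      intro x hx
      rw [uIcc_of_le (by norm_num)] at hx
      have hpos : 0 < 1 + x + κ := by linarith [hx.1]
      have h1 : HasDerivAt (fun x : ℝ => 1 + x + κ) 1 x := by
        simpa using ((hasDerivAt_id x).const_add (1:ℝ)).add_const κ
      have := (Real.hasDerivAt_log hpos.ne').comp x h1
      simpa [Function.comp_def] using this
    have hint : IntervalIntegrable (fun x => 1 / (1 + x + κ)) volume (-1) 0 := by
      refine ContinuousOn.intervalIntegrable ?_
      rw [uIcc_of_le (by norm_num)]
      exact ContinuousOn.div continuousOn_const (by fun_prop)
        (fun x hx => by have : 0 < 1 + x + κ := by linarith [hx.1]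
                        exact this.ne')
    rw [intervalIntegral.integral_eq_sub_of_hasDerivAt hderiv hint]
    simp
  have hr : ∫ x in (0:ℝ)..1, 1 / omega κ x = Real.log (1 + κ) - Real.log κ := by
    have heq : EqOn (fun x => 1 / omega κ x) (fun x => 1 / (1 - x + κ)) (uIcc (0:ℝ) 1) := by
      intro x hx
      rw [uIcc_of_le (by norm_num)] at hx
      simp only [omega, abs_of_nonneg hx.1]
    rw [intervalIntegral.integral_congr heq]
    have hderiv : ∀ x ∈ uIcc (0:ℝ) 1,
        HasDerivAt (fun x => -Real.log (1 - x + κ)) (1 / (1 - x + κ)) x := by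
      intro x hx
      rw [uIcc_of_le (by norm_num)] at hx
      have hpos : 0 < 1 - x + κ := by linarith [hx.2]
      have h1 : HasDerivAt (fun x : ℝ => 1 - x + κ) (-1) x := by
        simpa using ((hasDerivAt_id x).const_sub (1:ℝ)).add_const κ
      have := ((Real.hasDerivAt_log hpos.ne').comp x h1).neg
      refine this.congr_deriv ?_
      field_simp
    have hint : IntervalIntegrable (fun x => 1 / (1 - x + κ)) volume 0 1 := by
      refine ContinuousOn.intervalIntegrable ?_
      rw [uIcc_of_le (by norm_num)]
      exact ContinuousOn.div continuousOn_const (by fun_prop)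
        (fun x hx => by have : 0 < 1 - x + κ := by linarith [hx.2]
                        exact this.ne')
    rw [intervalIntegral.integral_eq_sub_of_hasDerivAt hderiv hint]
    simp only [sub_zero, sub_self, zero_add]
    ring_nf
  have i1 : IntervalIntegrable (fun x => 1 / omega κ x) volume (-1) 0 := by
    refine ContinuousOn.intervalIntegrable ?_
    rw [uIcc_of_le (by norm_num)]
    exact (continuousOn_inv_omega hκ).mono (Icc_subset_Icc_right (by norm_num))
  have i2 : IntervalIntegrable (fun x => 1 / omega κ x) volume 0 1 := by
    refine ContinuousOn.intervalIntegrable ?_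
    rw [uIcc_of_le (by norm_num)]
    exact (continuousOn_inv_omega hκ).mono (Icc_subset_Icc_left (by norm_num))
  rw [← intervalIntegral.integral_add_adjacent_intervals i1 i2, hl, hr]
  unfold ell
  rw [Real.log_div (by linarith) hκ.ne']
  ring

/-- Integrating a bound of the form `a + b/ω`. [folklore] -/
theorem integral_le_omega {κ a b : ℝ} (hκ : 0 < κ) {f : ℝ → ℝ}
    (hf : IntervalIntegrable f volume (-1) 1)
    (h : ∀ x ∈ Icc (-1:ℝ) 1, f x ≤ a + b * (1 / omega κ x)) :
    ∫ x in (-1:ℝ)..1, f x ≤ 2 * a + 2 * b * ell κ := by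
  have hint : IntervalIntegrable (fun x => a + b * (1 / omega κ x)) volume (-1) 1 := by
    refine ContinuousOn.intervalIntegrable ?_
    rw [uIcc_of_le (by norm_num)]
    exact continuousOn_const.add (continuousOn_const.mul (continuousOn_inv_omega hκ))
  calc ∫ x in (-1:ℝ)..1, f x ≤ ∫ x in (-1:ℝ)..1, (a + b * (1 / omega κ x)) :=
        intervalIntegral.integral_mono_on (by norm_num) hf hint h
    _ = 2 * a + 2 * b * ell κ := by
        rw [intervalIntegral.integral_add intervalIntegrable_const
          ((continuousOn_inv_omega hκ).intervalIntegrable_of_Icc (by norm_num) |>.const_mul b),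
          intervalIntegral.integral_const, intervalIntegral.integral_const_mul,
            integral_inv_omega hκ]
        simp; ring

/-- Integrating a two-sided bound `|f| ≤ a + b/ω`. [folklore] -/
theorem abs_integral_le_omega {κ a b : ℝ} (hκ : 0 < κ) {f : ℝ → ℝ}
    (hf : IntervalIntegrable f volume (-1) 1)
    (h : ∀ x ∈ Icc (-1:ℝ) 1, |f x| ≤ a + b * (1 / omega κ x)) :
    |∫ x in (-1:ℝ)..1, f x| ≤ 2 * a + 2 * b * ell κ := by
  refine abs_le.mpr ⟨?_, integral_le_omega hκ hf (fun x hx => (abs_le.mp (h x hx)).2)⟩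
  have := integral_le_omega hκ hf.neg (a := a) (b := b) (fun x hx => by
    have := (abs_le.mp (h x hx)).1; simp only [Pi.neg_apply]; linarith)
  simp only [Pi.neg_apply, intervalIntegral.integral_neg] at this
  linarith

/-! ### The three integrated estimates for a solution -/

section estimates
variable {κ : ℝ} {g : ℝ → ℝ}

/-- The edge functional `μ = ∫ (D/κ) g`. [folklore] -/
def muF (κ : ℝ) (g : ℝ → ℝ) : ℝ := ∫ x in (-1:ℝ)..1, Dq x κ / κ * g x

/-- The bulk functional `J = ∫ (1-x²)√(1-x²) D`. [folklore] -/
def JF (κ : ℝ) : ℝ := ∫ x in (-1:ℝ)..1, (1 - x ^ 2) * semi x * Dq x κ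

/-- The residual functional `R = ∫ r₀ (g - G₀)`. [folklore] -/
def RF (κ : ℝ) (g : ℝ → ℝ) : ℝ := ∫ x in (-1:ℝ)..1, r0 κ x * (g x - G0 κ x)

/-- `φ g` is integrable on `[-1,1]` for `φ ∈ C[-1,1]`. [folklore] -/
theorem IsLoveSolution.intervalIntegrable (hg : IsLoveSolution κ g) {φ : ℝ → ℝ}
    (hφ : ContinuousOn φ (Icc (-1) 1)) :
    IntervalIntegrable (fun x => φ x * g x) volume (-1) 1 := by
  refine ContinuousOn.intervalIntegrable ?_
  rw [uIcc_of_le (by norm_num)]; exact hφ.mul hg.continuousOn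

/-- `μ ≥ 0`. [folklore] -/
theorem muF_nonneg (hg : IsLoveSolution κ g) : 0 ≤ muF κ g := by
  unfold muF
  refine intervalIntegral.integral_nonneg (by norm_num) (fun x hx => ?_)
  exact mul_nonneg (div_nonneg (Dq_nonneg hg.pos hx) hg.pos.le) (hg.nonneg x hx)

/-- (B1) `μ ≤ 1 + 25 ℓ`. [folklore] -/
theorem muF_le (hg : IsLoveSolution κ g) (hκ1 : κ ≤ 1 / 4) : muF κ g ≤ 1 + 25 * ell κ := by
  have hκ := hg.pos
  have hπ := Real.pi_pos
  have hπ3 := Real.pi_gt_three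
  have hsk : 0 < √κ := Real.sqrt_pos.mpr hκ
  have hbound : ∀ x ∈ Icc (-1:ℝ) 1, Dq x κ / κ * g x ≤
      1 / (2 * π) + (1 / π + 12) * (1 / omega κ x) := by
    intro x hx
    have hω := omega_pos hκ hx
    have hD := Dq_nonneg hκ hx
    have hg1 := hg.le_G0_add hκ1 x hx
    have h1 : Dq x κ / κ * g x ≤ Dq x κ / κ * (G0 κ x + 2 / √κ) :=
      mul_le_mul_of_nonneg_left hg1 (by positivity)
    have h2 := Dq_mul_semi_le hκ hx
    have h3 := Dq_omega hκ hκ1 hx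
    have h3' : Dq x κ ≤ 6 * κ * √κ / omega κ x := by rw [le_div_iff₀ hω]; exact h3
    calc Dq x κ / κ * g x ≤ Dq x κ / κ * (G0 κ x + 2 / √κ) := h1
      _ = 1 / (2 * π * κ ^ 2) * (Dq x κ * semi x) + 2 / (κ * √κ) * Dq x κ := by
          unfold G0; field_simp
      _ ≤ 1 / (2 * π * κ ^ 2) * (κ ^ 2 + 2 * κ ^ 2 / omega κ x)
          + 2 / (κ * √κ) * (6 * κ * √κ / omega κ x) := by gcongr
      _ = 1 / (2 * π) + (1 / π + 12) * (1 / omega κ x) := by field_simp; ring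
  have hint : IntervalIntegrable (fun x => Dq x κ / κ * g x) volume (-1) 1 :=
    hg.intervalIntegrable ((continuous_Dq hκ.ne').div_const κ).continuousOn
  have := integral_le_omega hκ hint hbound
  unfold muF
  refine le_trans this ?_
  have hℓ := ell_nonneg hκ
  have e1 : 2 * (1 / (2 * π)) ≤ 1 := by
    rw [show 2 * (1 / (2 * π)) = 1 / π by field_simp]
    exact (div_le_one hπ).mpr (by linarith)
  have e2 : 2 * (1 / π + 12) ≤ 25 := by
    have : 1 / π ≤ 1 / 2 := by rw [div_le_div_iff₀ hπ (by norm_num)]; linarith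
    linarith
  nlinarith

/-- (B2) `|R| ≤ 28 √κ (1 + ℓ)`. [folklore] -/
theorem abs_RF_le (hg : IsLoveSolution κ g) (hκ1 : κ ≤ 1 / 4) :
    |RF κ g| ≤ 28 * √κ * (1 + ell κ) := by
  have hκ := hg.pos
  have hsk : 0 < √κ := Real.sqrt_pos.mpr hκ
  have hk : √κ * √κ = κ := Real.mul_self_sqrt hκ.le
  have hbound : ∀ x ∈ Icc (-1:ℝ) 1, |r0 κ x * (g x - G0 κ x)| ≤
      14 * √κ + 14 * √κ * (1 / omega κ x) := by
    intro x hx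
    have hω := omega_pos hκ hx
    have h1 := abs_r0_le hκ hκ1 hx
    have h2 : 0 ≤ g x - G0 κ x := by linarith [hg.G0_le x hx]
    have h3 : g x - G0 κ x ≤ 2 / √κ := by linarith [hg.le_G0_add hκ1 x hx]
    rw [abs_mul, abs_of_nonneg h2]
    calc |r0 κ x| * (g x - G0 κ x) ≤ 7 * κ * (1 + 1 / omega κ x) * (2 / √κ) := by gcongr
      _ = 14 * √κ + 14 * √κ * (1 / omega κ x) := by
          field_simp
          nlinarith [hk]
  have hint : IntervalIntegrable (fun x => r0 κ x * (g x - G0 κ x)) volume (-1) 1 := by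
    have := hg.intervalIntegrable (continuous_r0 hκ.ne').continuousOn
    have h2 : IntervalIntegrable (fun x => r0 κ x * G0 κ x) volume (-1) 1 :=
      ((continuous_r0 hκ.ne').mul (continuous_G0 κ)).intervalIntegrable _ _
    convert this.sub h2 using 1
    ext x; ring
  have := abs_integral_le_omega hκ hint hbound
  unfold RF
  linarith

/-- (B3) `κ² - 81 κ³ ℓ ≤ J ≤ κ²`. [folklore] -/
theorem JF_le (hκ : 0 < κ) : JF κ ≤ κ ^ 2 := by
  unfold JF
  have hint : IntervalIntegrable (fun x => (1 - x ^ 2) * semi x * Dq x κ) volume (-1) 1 :=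
    (((continuous_const.sub (continuous_pow 2)).mul continuous_semi).mul
      (continuous_Dq hκ.ne')).intervalIntegrable _ _
  calc ∫ x in (-1:ℝ)..1, (1 - x ^ 2) * semi x * Dq x κ ≤ ∫ x in (-1:ℝ)..1, κ ^ 2 / 2 := by
        refine intervalIntegral.integral_mono_on (by norm_num) hint intervalIntegrable_const
          (fun x hx => ?_)
        have h1 := two_semi_mul_Dq (κ := κ) hx
        have h2 := one_sub_sq_mul_pW_sq_le hκ hx
        have h3 : 0 ≤ (1 - x ^ 2) * Dq x κ ^ 2 :=
            mul_nonneg (by nlinarith [hx.1, hx.2]) (sq_nonneg _)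
        nlinarith [h1, h2, h3]
    _ = κ ^ 2 := by rw [intervalIntegral.integral_const]; simp; ring

/-- (B3, lower) `κ² - 81 κ³ ℓ ≤ J`. [folklore] -/
theorem JF_ge (hκ : 0 < κ) (hκ1 : κ ≤ 1 / 4) : κ ^ 2 - 81 * κ ^ 3 * ell κ ≤ JF κ := by
  unfold JF
  have hint : IntervalIntegrable (fun x => (1 - x ^ 2) * semi x * Dq x κ) volume (-1) 1 :=
    (((continuous_const.sub (continuous_pow 2)).mul continuous_semi).mul
      (continuous_Dq hκ.ne')).intervalIntegrable _ _
  have := integral_le_omega hκ hint.neg (a := -(κ ^ 2 / 2)) (b := 81 / 2 * κ ^ 3) (fun x hx => by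
    have h1 := two_semi_mul_Dq (κ := κ) hx
    have h2 := one_sub_sq_mul_pW_sq_ge hκ hκ1 hx
    have h3 := one_sub_sq_mul_Dq_sq hκ hκ1 hx
    have hω := omega_pos hκ hx
    simp only [Pi.neg_apply]
    have e : (1 - x ^ 2) * semi x * Dq x κ =
        ((1 - x ^ 2) * κ ^ 2 + (1 - x ^ 2) * pW x κ ^ 2 - (1 - x ^ 2) * Dq x κ ^ 2) / 2 := by
      nlinarith [h1]
    rw [e]
    have : 9 * κ ^ 3 / omega κ x + 72 * κ ^ 3 / omega κ x = 81 * κ ^ 3 * (1 / omega κ x) := by ring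
    nlinarith [h2, h3, this])
  simp only [Pi.neg_apply, intervalIntegral.integral_neg] at this
  linarith

end estimates


/-! ## Part F. Assembly: `Δ = m₂ - κm₀² + (4/3π)(κm₀)^{3/2} → 0` -/

section assembly
variable {κ : ℝ} {g : ℝ → ℝ}

/-- Zeroth moment `m₀ = ∫ g`. [folklore] -/
def m0F (g : ℝ → ℝ) : ℝ := ∫ x in (-1:ℝ)..1, g x

/-- Second moment `m₂ = ∫ x² g`. [folklore] -/
def m2F (g : ℝ → ℝ) : ℝ := ∫ x in (-1:ℝ)..1, x ^ 2 * g x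

/-- The small parameter `u(κ) = √κ (1 + log((1+κ)/κ))`. [folklore] -/
def uF (κ : ℝ) : ℝ := √κ * (1 + ell κ)

/-- `m₀ = 1/(4κ) + μ`. [folklore] -/
theorem m0F_eq (hg : IsLoveSolution κ g) : m0F g = 1 / (4 * κ) + muF κ g := hg.integral_eq

/-- `∫ w g = 1/(8κ) + J/(3πκ²) + R`. [folklore] -/
theorem integral_w_eq' (hg : IsLoveSolution κ g) :
    ∫ x in (-1:ℝ)..1, (1 - 2 * x ^ 2) * g x =
      1 / (8 * κ) + JF κ / (3 * π * κ ^ 2) + RF κ g := by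
  have hκ := hg.pos
  rw [hg.integral_w_eq]
  have : ∫ x in (-1:ℝ)..1, psi0 κ x * Dq x κ = 2 / (3 * κ) * JF κ := by
    unfold JF psi0
    rw [← intervalIntegral.integral_const_mul]
    congr 1; ext x; ring
  rw [this]
  unfold RF
  field_simp

/-- `m₂ = (m₀ - ∫ w g)/2`. [folklore] -/
theorem m2F_eq (hg : IsLoveSolution κ g) :
    m2F g = (m0F g - ∫ x in (-1:ℝ)..1, (1 - 2 * x ^ 2) * g x) / 2 := by
  unfold m2F m0F
  have i0 := hg.intervalIntegrable continuousOn_const (φ := fun _ => (1:ℝ))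
  have i2 := hg.intervalIntegrable (continuous_pow 2).continuousOn (φ := fun x : ℝ => x ^ 2)
  simp only [one_mul] at i0
  have : ∫ x in (-1:ℝ)..1, (1 - 2 * x ^ 2) * g x =
      (∫ x in (-1:ℝ)..1, g x) - 2 * ∫ x in (-1:ℝ)..1, x ^ 2 * g x := by
    rw [← intervalIntegral.integral_const_mul, ← intervalIntegral.integral_sub i0 (i2.const_mul 2)]
    congr 1; ext x; ring
  rw [this]; ring

/-- Elementary: for `0 ≤ t ≤ 1`, `0 ≤ (1/4+t)√(1/4+t) - 1/8 ≤ 2t`. [folklore] -/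
theorem pow32_bounds {t : ℝ} (ht0 : 0 ≤ t) (ht1 : t ≤ 1) :
    0 ≤ (1 / 4 + t) * √(1 / 4 + t) - 1 / 8 ∧ (1 / 4 + t) * √(1 / 4 + t) - 1 / 8 ≤ 2 * t := by
  have hs1 : 1 / 2 ≤ √(1 / 4 + t) := by
    rw [show (1 / 2 : ℝ) = √(1 / 4) by
      rw [show (1 / 4 : ℝ) = (1 / 2) ^ 2 by norm_num, Real.sqrt_sq (by norm_num)]]
    exact Real.sqrt_le_sqrt (by linarith)
  have hs2 : √(1 / 4 + t) ≤ 1 / 2 + t := by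
    rw [Real.sqrt_le_left (by positivity)]
    nlinarith
  constructor
  · nlinarith
  · nlinarith

/-- `|a + b - c - d| ≤ |a| + |b| + |c| + |d|`. [folklore] -/
theorem abs_add_sub_sub_le (a b c d : ℝ) : |a + b - c - d| ≤ |a| + |b| + |c| + |d| := by
  have h1 := abs_add_le a b
  have h2 := abs_sub (a + b) c
  have h3 := abs_sub (a + b - c) d
  linarith

/-- The algebraic decomposition of `Δ` (with `s` standing for `√(κ m₀)`). [folklore] -/
theorem delta_decomp (κ μ J R s : ℝ) (hκ : κ ≠ 0) :
    (1 / (16 * κ) + μ / 2 - J / (6 * π * κ ^ 2) - R / 2) - κ * (1 / (4 * κ) + μ) ^ 2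
        + 4 / (3 * π) * (1 / 4 + κ * μ) * s =
      4 / (3 * π) * ((1 / 4 + κ * μ) * s - 1 / 8) + 1 / (6 * π) * (1 - J / κ ^ 2)
        - R / 2 - κ * μ ^ 2 := by
  have hπ := Real.pi_pos.ne'
  field_simp
  ring

/-- The arithmetic of the four error terms. [folklore] -/
theorem delta_arith {κ μ J R ℓ u : ℝ} (hκ : 0 < κ) (hκ1 : κ ≤ 1 / 4) (hℓ : 0 ≤ ℓ)
    (hudef : u = √κ * (1 + ℓ)) (hu : u ≤ 1 / 625)
    (hμ0 : 0 ≤ μ) (hμ1 : μ ≤ 1 + 25 * ℓ) (hR : |R| ≤ 28 * √κ * (1 + ℓ))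
    (hJ1 : J ≤ κ ^ 2) (hJ2 : κ ^ 2 - 81 * κ ^ 3 * ℓ ≤ J) :
    |4 / (3 * π) * ((1 / 4 + κ * μ) * √(1 / 4 + κ * μ) - 1 / 8) + 1 / (6 * π) * (1 - J / κ ^ 2)
        - R / 2 - κ * μ ^ 2| ≤ 31 * u ∧ κ * μ ≤ 1 := by
  have hπ := Real.pi_pos
  have hπ3 := Real.pi_gt_three
  have hsk : 0 < √κ := Real.sqrt_pos.mpr hκ
  have hsk1 : √κ ≤ 1 / 2 := by rw [Real.sqrt_le_left (by norm_num)]; linarith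
  have hkk : √κ * √κ = κ := Real.mul_self_sqrt hκ.le
  have hu0 : 0 ≤ u := by rw [hudef]; positivity
  have hκu : κ * (1 + ℓ) ≤ u / 2 := by
    rw [hudef]
    calc κ * (1 + ℓ) = √κ * (√κ * (1 + ℓ)) := by rw [← mul_assoc, hkk]
      _ ≤ 1 / 2 * (√κ * (1 + ℓ)) := by gcongr
      _ = √κ * (1 + ℓ) / 2 := by ring
  have ht0 : 0 ≤ κ * μ := by positivity
  have ht1 : κ * μ ≤ 13 * u := by
    calc κ * μ ≤ κ * (1 + 25 * ℓ) := by gcongr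
      _ ≤ 25 * (κ * (1 + ℓ)) := by nlinarith
      _ ≤ 25 * (u / 2) := by gcongr
      _ ≤ 13 * u := by linarith
  have ht1' : κ * μ ≤ 1 := by linarith
  refine ⟨?_, ht1'⟩
  obtain ⟨hp0, hp1⟩ := pow32_bounds ht0 ht1'
  have e1 : |4 / (3 * π) * ((1 / 4 + κ * μ) * √(1 / 4 + κ * μ) - 1 / 8)| ≤ 13 * u := by
    rw [abs_of_nonneg (by positivity)]
    have : 4 / (3 * π) ≤ 1 / 2 := by
      rw [div_le_div_iff₀ (by positivity) (by norm_num)]; linarith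
    calc 4 / (3 * π) * ((1 / 4 + κ * μ) * √(1 / 4 + κ * μ) - 1 / 8) ≤ 1 / 2 * (2 * (κ * μ)) := by
          gcongr
      _ = κ * μ := by ring
      _ ≤ 13 * u := ht1
  have e2 : |1 / (6 * π) * (1 - J / κ ^ 2)| ≤ 3 * u := by
    have hJ3 : 0 ≤ 1 - J / κ ^ 2 := by
      rw [sub_nonneg, div_le_one (by positivity)]; exact hJ1
    have hJ4 : 1 - J / κ ^ 2 ≤ 81 * (κ * ℓ) := by
      have h1 : (κ ^ 2 - 81 * κ ^ 3 * ℓ) / κ ^ 2 ≤ J / κ ^ 2 :=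
        div_le_div_of_nonneg_right hJ2 (by positivity)
      have h2 : (κ ^ 2 - 81 * κ ^ 3 * ℓ) / κ ^ 2 = 1 - 81 * (κ * ℓ) := by
        field_simp
      linarith
    rw [abs_of_nonneg (by positivity)]
    have : 1 / (6 * π) ≤ 1 / 18 := by
      rw [div_le_div_iff₀ (by positivity) (by norm_num)]; linarith
    calc 1 / (6 * π) * (1 - J / κ ^ 2) ≤ 1 / 18 * (81 * (κ * ℓ)) := by gcongr
      _ ≤ 1 / 18 * (81 * (κ * (1 + ℓ))) := by gcongr; nlinarith
      _ ≤ 1 / 18 * (81 * (u / 2)) := by gcongr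
      _ ≤ 3 * u := by linarith
  have e3 : |R / 2| ≤ 14 * u := by
    rw [abs_div, abs_two]
    have : 28 * √κ * (1 + ℓ) = 28 * u := by rw [hudef]; ring
    linarith
  have e4 : |κ * μ ^ 2| ≤ u := by
    rw [abs_of_nonneg (by positivity)]
    calc κ * μ ^ 2 ≤ κ * (1 + 25 * ℓ) ^ 2 := by gcongr
      _ ≤ 625 * (κ * (1 + ℓ) ^ 2) := by nlinarith
      _ = 625 * (√κ * (1 + ℓ)) ^ 2 := by rw [mul_pow, Real.sq_sqrt hκ.le]
      _ = 625 * u ^ 2 := by rw [hudef]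
      _ ≤ 625 * (1 / 625 * u) := by rw [sq]; gcongr
      _ = u := by ring
  calc |4 / (3 * π) * ((1 / 4 + κ * μ) * √(1 / 4 + κ * μ) - 1 / 8) + 1 / (6 * π) * (1 - J / κ ^ 2)
        - R / 2 - κ * μ ^ 2|
      ≤ |4 / (3 * π) * ((1 / 4 + κ * μ) * √(1 / 4 + κ * μ) - 1 / 8)|
        + |1 / (6 * π) * (1 - J / κ ^ 2)| + |R / 2| + |κ * μ ^ 2| := abs_add_sub_sub_le _ _ _ _
    _ ≤ 13 * u + 3 * u + 14 * u + u := by gcongr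
    _ = 31 * u := by ring

/-- **The key estimate.** For a solution with `κ ≤ 1/4` and `u(κ) ≤ 1/625`:
`|m₂ - κ m₀² + (4/3π)(κm₀)√(κm₀)| ≤ 31 u(κ)`, and `κ m₀ ≥ 1/4`. [folklore] -/
theorem IsLoveSolution.delta_bound (hg : IsLoveSolution κ g) (hκ1 : κ ≤ 1 / 4)
    (hu : uF κ ≤ 1 / 625) :
    |m2F g - κ * m0F g ^ 2 + 4 / (3 * π) * (κ * m0F g) * √(κ * m0F g)| ≤ 31 * uF κ
      ∧ 1 / 4 ≤ κ * m0F g := by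
  have hκ := hg.pos
  have hm0 : m0F g = 1 / (4 * κ) + muF κ g := m0F_eq hg
  have hm2 : m2F g = 1 / (16 * κ) + muF κ g / 2 - JF κ / (6 * π * κ ^ 2) - RF κ g / 2 := by
    rw [m2F_eq hg, integral_w_eq' hg, hm0]
    ring
  have hT : κ * m0F g = 1 / 4 + κ * muF κ g := by
    rw [hm0, mul_add, mul_one_div, show κ / (4 * κ) = 1 / 4 by field_simp]
  obtain ⟨h1, h2⟩ := delta_arith hκ hκ1 (ell_nonneg hκ) (rfl : uF κ = √κ * (1 + ell κ)) hu
    (muF_nonneg hg) (muF_le hg hκ1) (abs_RF_le hg hκ1) (JF_le hκ) (JF_ge hκ hκ1)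
  refine ⟨?_, by rw [hT]; linarith [mul_nonneg hκ.le (muF_nonneg hg)]⟩
  rw [hT, hm2, hm0, delta_decomp κ (muF κ g) (JF κ) (RF κ g) _ hκ.ne']
  exact h1

end assembly


/-! ### `u(κ) → 0` as `κ → 0⁺` -/

/-- `u(κ) → 0` as `κ → 0⁺` (`√κ log κ → 0`). [folklore] -/
theorem tendsto_uF : Tendsto uF (𝓝[>] (0:ℝ)) (𝓝 0) := by
  -- `u = √κ + √κ log(1+κ) - √κ log κ` on `(0, ∞)`
  have h1 : Tendsto (fun κ : ℝ => √κ) (𝓝[>] (0:ℝ)) (𝓝 0) := by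
    have := (Real.continuous_sqrt.tendsto (0:ℝ))
    rw [Real.sqrt_zero] at this
    exact tendsto_nhdsWithin_of_tendsto_nhds this
  have h2 : Tendsto (fun κ : ℝ => Real.log (1 + κ)) (𝓝[>] (0:ℝ)) (𝓝 0) := by
    have hc : ContinuousAt (fun κ : ℝ => Real.log (1 + κ)) 0 :=
      (Real.continuousAt_log (by norm_num)).comp (f := fun κ : ℝ => 1 + κ)
        (by exact Continuous.continuousAt (by fun_prop : Continuous fun κ : ℝ => 1 + κ))
    have := hc.tendsto
    simp only [add_zero, Real.log_one] at this
    exact tendsto_nhdsWithin_of_tendsto_nhds this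
  have h3 : Tendsto (fun κ : ℝ => Real.log κ * √κ) (𝓝[>] (0:ℝ)) (𝓝 0) := by
    have := tendsto_log_mul_rpow_nhdsGT_zero (r := 1 / 2) (by norm_num)
    refine this.congr' ?_
    filter_upwards [self_mem_nhdsWithin] with κ hκ
    rw [Real.sqrt_eq_rpow]
  have hsum := (h1.add (h1.mul h2)).sub h3
  simp only [add_zero, mul_zero, sub_zero] at hsum
  refine hsum.congr' ?_
  filter_upwards [self_mem_nhdsWithin] with κ hκ
  simp only [mem_Ioi] at hκ
  unfold uF ell
  rw [Real.log_div (by linarith) hκ.ne']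
  ring

/-- `ε`-form of `u(κ) → 0`. [folklore] -/
theorem exists_kappa0 {δ : ℝ} (hδ : 0 < δ) :
    ∃ κ₀ : ℝ, 0 < κ₀ ∧ ∀ κ : ℝ, 0 < κ → κ < κ₀ → uF κ < δ := by
  have hev : ∀ᶠ κ in 𝓝[>] (0:ℝ), uF κ < δ := tendsto_uF (Iio_mem_nhds hδ)
  rw [eventually_nhdsWithin_iff, Metric.eventually_nhds_iff] at hev
  obtain ⟨κ₀, hκ₀, h⟩ := hev
  refine ⟨κ₀, hκ₀, fun κ hκ hκlt => h ?_ hκ⟩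
  simpa [Real.dist_eq, abs_of_pos hκ] using hκlt

/-! ### Scaling: from `IsGroundStateDensity` to `IsLoveSolution` -/

/-- The scaling `g(x) = f(Kx)`, `κ = c/K` of (B.14)–(B.15) to the Love equation on `[-1,1]`, with
`∫ g = ρ/K` and `e = m₂/m₀³`. [cite: LSSY2005, App. B (B.14)–(B.18)] -/
theorem scaling {c ρ K : ℝ} {f : ℝ → ℝ} (hc : 0 < c) (h : IsGroundStateDensity c ρ K f) :
    IsLoveSolution (c / K) (fun x => f (K * x)) ∧ m0F (fun x => f (K * x)) = ρ / K ∧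
      scaledEnergy ρ K f = m2F (fun x => f (K * x)) / (ρ / K) ^ 3 ∧
      m2F (fun x => f (K * x)) = (∫ k in (-K)..K, f k * k ^ 2) / K ^ 3 := by
  have hK := h.K_pos
  have hκ : 0 < c / K := by positivity
  -- continuity of `g` on `[-1,1]`
  have hg : ContinuousOn (fun x => f (K * x)) (Icc (-1:ℝ) 1) := by
    refine h.continuousOn.comp (by fun_prop) (fun x hx => ?_)
    constructor <;> nlinarith [hx.1, hx.2]
  -- the second moment
  have hm2 : m2F (fun x => f (K * x)) = (∫ k in (-K)..K, f k * k ^ 2) / K ^ 3 := by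
    unfold m2F
    have : (fun x : ℝ => x ^ 2 * f (K * x)) = fun x => (fun p => (p / K) ^ 2 * f p) (K * x) := by
      ext x; field_simp
    rw [this, intervalIntegral.integral_comp_mul_left (fun p => (p / K) ^ 2 * f p) hK.ne']
    simp only [mul_neg, mul_one, smul_eq_mul]
    rw [show (∫ k in (-K)..K, f k * k ^ 2) = ∫ k in (-K)..K, K ^ 2 * ((k / K) ^ 2 * f k) by
      congr 1; ext k; field_simp, intervalIntegral.integral_const_mul]
    field_simp
  -- the zeroth moment
  have hm0 : m0F (fun x => f (K * x)) = ρ / K := by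
    unfold m0F
    rw [intervalIntegral.integral_comp_mul_left f hK.ne']
    simp only [mul_neg, mul_one, smul_eq_mul, h.norm]
    field_simp
  refine ⟨⟨hκ, hg, fun x hx => ?_⟩, hm0, ?_, hm2⟩
  · -- the equation
    have hKx : K * x ∈ Icc (-K) K := by constructor <;> nlinarith [hx.1, hx.2]
    have heq := h.eq (K * x) hKx
    set F : ℝ → ℝ := fun p => f p / (c ^ 2 + (p - K * x) ^ 2) with hF
    have hT : loveOp (c / K) (fun y => f (K * y)) x = c / π * ∫ p in (-K)..K, F p := by
      unfold loveOp loveKernel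
      have hpt : ∀ y : ℝ, c / K / ((c / K) ^ 2 + (x - y) ^ 2) / π * f (K * y) =
          c * K / π * F (K * y) := by
        intro y
        simp only [hF]
        have h1 : (c / K) ^ 2 + (x - y) ^ 2 ≠ 0 := by positivity
        have h2 : c ^ 2 + (K * y - K * x) ^ 2 ≠ 0 := by positivity
        field_simp
        ring
      rw [intervalIntegral.integral_congr (fun y _ => hpt y), intervalIntegral.integral_const_mul,
        intervalIntegral.integral_comp_mul_left F hK.ne']
      simp only [mul_neg, mul_one, smul_eq_mul]
      field_simp
    rw [hT]
    have : ∫ p in (-K)..K, F p = (2 * π * f (K * x) - 1) / (2 * c) := by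
      rw [eq_div_iff (by positivity)]; simp only [hF]; linarith
    rw [this]
    field_simp
    ring
  · unfold scaledEnergy
    rw [hm2]
    field_simp


/-! ### The theorem -/

/-- **Lieb–Liniger (B.19): Bogoliubov's energy is asymptotically exact to two orders for the
`δ`-function Bose gas.** For every solution of (B.14)–(B.15) with `γ = c/ρ → 0⁺`,
`e(γ) = γ - (4/3π)γ^{3/2} + o(γ^{3/2})`.  Discharges the named fact
`LiebLiniger_bogoliubovTwoOrders` (and hence the catalogue entry
`EnergyAsymptoticsWithoutCondensation`).  The printed derivations go through Bogoliubov's method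
[cite: LSSY2005, App. B (B.19)] or Hutson's uniform approximation of Love's equation
[cite: TracyWidom2016, §1.2]; the proof here is the elementary duality/barrier argument of this
file. [cite: LSSY2005, App. B (B.19)] -/
theorem LiebLiniger_bogoliubovTwoOrders_holds : LiebLiniger_bogoliubovTwoOrders := by
  intro ε hε
  obtain ⟨κ₁, hκ₁, hU⟩ := exists_kappa0 (δ := min (1 / 625) (ε / 248)) (by positivity)
  set κ₀ := min κ₁ (1 / 4) with hκ₀def
  have hκ₀ : 0 < κ₀ := lt_min hκ₁ (by norm_num)
  have hκ₀1 : κ₀ ≤ 1 / 4 := min_le_right _ _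
  have ha0 : 0 < arctan (κ₀ / 2) := by
    rw [← arctan_zero]; exact arctan_strictMono (by positivity)
  refine ⟨2 * κ₀ * arctan (κ₀ / 2), by positivity, ?_⟩
  intro c ρ K f hc hρ hγ hf
  obtain ⟨hsol, hm0, hsc, -⟩ := scaling hc hf
  have hK := hf.K_pos
  have hκ : 0 < c / K := hsol.pos
  have hm0pos : 0 < m0F (fun x => f (K * x)) := by rw [hm0]; positivity
  have hγ' : c / ρ = (c / K) / m0F (fun x => f (K * x)) := by
    rw [hm0]; field_simp
  -- Step 1: `κ < κ₀` (otherwise `γ ≥ 2κ arctan(κ/2) ≥ γ₀`).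
  have hκlt : c / K < κ₀ := by
    by_contra! hle
    have h1 : m0F (fun x => f (K * x)) ≤ 1 / (2 * arctan (c / K / 2)) := hsol.integral_le
    have ha : arctan (κ₀ / 2) ≤ arctan (c / K / 2) := arctan_mono (by linarith)
    have hapos : 0 < arctan (c / K / 2) := lt_of_lt_of_le ha0 ha
    have h2 : 2 * κ₀ * arctan (κ₀ / 2) ≤ c / ρ := by
      rw [hγ', le_div_iff₀ hm0pos]
      calc 2 * κ₀ * arctan (κ₀ / 2) * m0F (fun x => f (K * x))
          ≤ 2 * κ₀ * arctan (κ₀ / 2) * (1 / (2 * arctan (c / K / 2))) := by gcongr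
        _ = κ₀ * (arctan (κ₀ / 2) / arctan (c / K / 2)) := by field_simp
        _ ≤ κ₀ * 1 := by gcongr; rw [div_le_one hapos]; exact ha
        _ ≤ c / K := by linarith
    linarith
  have hκ1 : c / K ≤ 1 / 4 := le_trans hκlt.le hκ₀1
  have huκ := hU (c / K) hκ (lt_of_lt_of_le hκlt (min_le_left _ _))
  have hu1 : uF (c / K) ≤ 1 / 625 := le_trans huκ.le (min_le_left _ _)
  have hu2 : uF (c / K) ≤ ε / 248 := le_trans huκ.le (min_le_right _ _)
  -- Step 2: the key estimate.
  obtain ⟨hΔ, hT⟩ := hsol.delta_bound hκ1 hu1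
  set m0 := m0F (fun x => f (K * x)) with hm0def
  set m2 := m2F (fun x => f (K * x)) with hm2def
  set κ := c / K with hκdef
  -- Step 3: translate to `e` and `e_B`.
  rw [hsc, ← hm0, hγ']
  unfold bogoliubovEnergy
  have hγpos : 0 < κ / m0 := by positivity
  rw [show (κ / m0) ^ (3 / 2 : ℝ) = (κ / m0) * √(κ / m0) by
    rw [show (3 / 2 : ℝ) = 1 + 1 / 2 by norm_num, Real.rpow_add hγpos, Real.rpow_one,
      Real.sqrt_eq_rpow]]
  have hsm : √(κ / m0) = √(κ * m0) / m0 := by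
    rw [Real.sqrt_div' κ hm0pos.le, Real.sqrt_mul' κ hm0pos.le,
      div_eq_div_iff (Real.sqrt_pos.mpr hm0pos).ne' hm0pos.ne', mul_assoc,
      Real.mul_self_sqrt hm0pos.le]
  rw [hsm]
  have key : m2 / m0 ^ 3 - (κ / m0 - 4 / (3 * π) * (κ / m0 * (√(κ * m0) / m0))) =
      (m2 - κ * m0 ^ 2 + 4 / (3 * π) * (κ * m0) * √(κ * m0)) / m0 ^ 3 := by
    field_simp
    ring
  rw [key, abs_div, abs_of_pos (pow_pos hm0pos 3), div_le_iff₀ (pow_pos hm0pos 3)]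
  have e2 : ε * (κ / m0 * (√(κ * m0) / m0)) * m0 ^ 3 = ε * ((κ * m0) * √(κ * m0)) := by
    field_simp
  rw [e2]
  have hsT : 1 / 2 ≤ √(κ * m0) := by
    rw [show (1 / 2 : ℝ) = √(1 / 4) by
      rw [show (1 / 4 : ℝ) = (1 / 2) ^ 2 by norm_num, Real.sqrt_sq (by norm_num)]]
    exact Real.sqrt_le_sqrt hT
  calc |m2 - κ * m0 ^ 2 + 4 / (3 * π) * (κ * m0) * √(κ * m0)| ≤ 31 * uF κ := hΔ
    _ ≤ 31 * (ε / 248) := by gcongr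
    _ = ε * (1 / 4 * (1 / 2)) := by ring
    _ ≤ ε * ((κ * m0) * √(κ * m0)) := by gcongr

end Literature.Barriers.AtomisticToContinuum.BoseGas.LiebLiniger
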